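import Literature.MathematicalPhysics.QuantumFieldTheory.Balaban1983to89.B9Thm313WholeGGEntriesMembers
import Literature.MathematicalPhysics.QuantumFieldTheory.Balaban1983to89.B9Thm313WholeGGProbesMembers
import Literature.MathematicalPhysics.QuantumFieldTheory.Balaban1983to89.B9Thm313WholeGGInputsMembers
import Literature.MathematicalPhysics.QuantumFieldTheory.Balaban1983to89.B9Thm313WholeGGBlocksEntries
import Literature.MathematicalPhysics.QuantumFieldTheory.Balaban1983to89.B9Thm313WholeBlocksPairMBCZCut
import Literature.MathematicalPhysics.QuantumFieldTheory.Balaban1983to89.B9Thm312WholeMembersRegular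

/-!
# `Balaban1983to89.B9Thm313WholeGGBlocksRegular` — T. Bałaban, *Propagators for lattice gauge theories in a background field*, Commun. Math. Phys. **99** (1985) 389–434
# [`Balaban1985BackgroundPropagators`], Theorem 3.13 p. 426 (row 21): the sup entries, the L² block (3.46) and the Hölder∕input block (3.43)–(3.45) of a kernel family co-read
# by 𝔊 = G₁𝔓\*, FROM THE REGULAR STATE — the G₁-level members derived by the first resolvent form from the right entries of G₁ INTO two state classes 𝔖₂ ∕ 𝔖₁, the
# step fields OUT OF them and their sup readings, then fed to the member∕entry-line cores `…GGEntriesMembers ∕ …GGProbesMembers ∕ …GGInputsMembers ∕ …GGBlocksEntries`;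
# NO `Step.step1 ∕ LeftStep.stepD1 ∕ StepDirB.…1 ∕ Letters313IM.tDv` is consumed

[4] = T. Bałaban, *Propagators and renormalization transformations for lattice gauge theories. II*, Commun. Math. Phys. **96** (1984) 223–250 [`Balaban1984PropagatorsII`].
statement-level skeleton of published theorems with citation tags; proofs where landed; nothing here is a claim about the Yang–Mills mass gap.

THE PRINT.  Thm 3.13 p. 426; Thm 3.12 pp. 421–423 (the members of G₁ over the induction state of Theorem 3.3's type, *"in all norms (3.42)–(3.47)"*); (3.42)–(3.47) pp. 397–398;
(3.152)–(3.153) p. 426.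

WHY THIS FILE (cell `pub-ymgap`, node N06, bundle F7 rows 20–21, seat dag-n06-l g27; programme P-U8S step S5f-A — the per-member residual of the row-21 S-leaf).  One member, one
configuration: from the right entries of G₁ INTO the state classes (`G₁`, `G₁D`, `G₁Q\*` INTO 𝔖₂; `G₁∇\*`, `G₁∇\*_μ`, `G₁D` (Hölder input), `G₁Q\*` (length-weighted) INTO 𝔖₁ —
the leaf gets them from the producers by `B9Thm312WholeStepRegular.hasMaj_right_of_stepS`), the step fields OUT OF the states and the sup readings, Theorem 3.3's probe∕input members
and the letters of record (`Letters313Zc ∕ DZ ∕ DMZ ∕ HZc ∕ HHZ ∕ IMBC`, `Ids3152`, the L² letters), ★★★ `GG_blocks_of_stateS` derives the three sup entries of 𝔊 (at ONE constant),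
its L² block and its Hölder∕input block — the `hent ∕ hres` of `B9Thm313WholeLeafRelZCutUE.thm313Printed_of_entriesRelZcU` — with every constant an explicit polynomial in the
(uniform) input constants.
HONEST SCOPE.  Re-assembly of landed pieces; every analytic member is a HYPOTHESIS of printed species; nothing of [B9]∕[4] asserted; no pin, no certificate edit; COUNT-NEUTRAL;
N06 NOT discharged; nothing continuum ∕ OS positivity ∕ mass gap.  Cell `pub-ymgap` (HUMAN RULING D-0062), Track A node N06 [B9], seat `pub-ymgap-dag-n06-l` (g27), 2026-08-29.
NEW file; nothing landed is modified.
-/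

namespace Literature.MathematicalPhysics.QuantumFieldTheory.Balaban1983to89.B9Thm313WholeGGBlocksRegular

open Literature.MathematicalPhysics.QuantumFieldTheory.Balaban1983to89
open Finset B6RandomWalk B6RandomWalkHom B9Thm34Ext B9Thm37GlueCor36 B11SectG B9SectDSup B9SectDL2Decay
open B9Thm37AllNorms B9Thm37AllNormsInstances B9FromB6 B9FromB6ModelSignsOn B9SectBStepWhole B9Thm312Whole B9Thm312WholeLeaf B9Thm312WholeLeft
open B9Thm313Whole B9Thm313WholeLeft B9RWSums343Holder B9RWSumsReadsRel B9RWSumsReadsNbr B9Ineq347 B9Thm312WholeClasses B9Thm312WholeL2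
open B9Thm312WholeBlocksRel B9Thm312WholeBlocksNbr B9Thm312WholeHolder B9Thm312WholeHHolder B9Thm313WholeHolder B9Thm313WholeL2G B9Thm313WholeL2GP
open B9Thm313WholeInput B9Thm313WholeBlocksNbr B9RWSums346SecondDiff B9Thm313WholeBlocksNbrRec B9RWSums344InputFam B9Thm312WholeDir
open B9Thm312WholeBlocksPairM B9Thm313WholeDir B9Thm313WholeDirInput B9Thm313WholeBlocksPairM B9Thm312WholeDirB B9Thm313WholeDirInputB
open B9Thm313WholeBlocksPairMB B9Thm313WholeZ B9Thm313WholeLeftZ B9Thm313WholeHolderZ B9Thm313WholeInputZ B9Thm313WholeDirZ B9Thm313WholeDirInputZ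
open B9Thm313WholeDirInputBZ B9Thm313WholeL2GZ B9Thm313WholeL2GPZ B9Thm313WholeDirL2Z B9Thm313WholeBlocksPairMZ B9Thm313WholeBlocksPairMBZ
open B9Thm313WholeInputC B9Thm313WholeDirInputBC B9Thm313WholeBlocksPairMBCZ B9Thm313WholeRgdFrom3152 B9Thm313WholeLettersCut B9Thm313WholeCutCores
open B9Thm313WholeBlocksPairMZCut B9Thm313WholeDirInputBCZCut B9Thm312WholeHZ B9Thm312WholeStepDirFrom3131 B9Thm37Glue B9Thm312WholeBlocksNbrRec
open B9Thm313WholeSupReadersCut B9Thm313WholeL2MixedCut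
open B9Thm312WholeStepRegular B9Thm312WholeMembersRegular B9Thm313WholeGGEntriesMembers B9Thm313WholeGGProbesMembers B9Thm313WholeGGInputsMembers
open B9Thm313WholeGGBlocksEntries

noncomputable section

section OneMember

variable {g : B9.Geometry} {B : B9.Backgrounds} {X Y Z W PX PY P : Type}
variable [Fintype X] [Fintype Y] [Fintype Z] [Fintype W] [Fintype PX] [Fintype PY] [Fintype P] [Fintype g.Site] [DecidableEq g.Site]
variable {R₀ : ℝ} {H₀ : Prop}

/-! ## §1 The three sup entries of 𝔊 from the state -/

omit [Fintype PX] [Fintype PY] [Fintype P] [DecidableEq g.Site] in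
/-- ★★ **THE THREE SUP ENTRIES OF 𝔊 FROM THE REGULAR STATE** (one member, one configuration): the right entries of G₁ INTO 𝔖₂ ∕ 𝔖₁ read in the sup classes
(`hasMaj_read_of_state`), the left-and-right entries ∇_UG₁, (∇_UG₀T)(G₁D), ∇_UG₁Q\* by the first resolvent form (`hasMaj_left_rightS`, the state field ∇_UG₀T : 𝔖₂ → 𝔠_Y⁽¹⁾),
then `GG_entry0∕1∕2_of_members`; all three brought to ANY constant `C_e` above the three displayed polynomials (`hCea ∕ hCeb ∕ hCec`), at the rate ρ′ (ρ′ + 3σ ≤ ρ,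
ρ + σ = ρ₁, ρ + 2σ ≤ min(δ_P, δ_K), ρ ≤ min(δ₀, δ₃)).
[cite: Balaban1985BackgroundPropagators, Thm 3.13 p.426 + Thm 3.12 p.423 + (3.42) p.397 + (3.152)–(3.153) p.426; Balaban1984PropagatorsII, (2.52)–(2.56) pp.232–233 + Lemma 2.1 (2.61) p.234] -/
theorem GG_entries_of_stateS (hG : GeoOK g) {𝔬 : Ops g B X Y Z W} {U : B.Cfg} {bH : BlockNorm (toB6 g R₀ H₀) (W → ℝ)} {Gp : B.Cfg → Module.End ℝ (W → ℝ)}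
    {bXH : BlockNorm (toB6 g R₀ H₀) (X → ℝ)} (𝔖₂ 𝔖₁ : BlockNorm (toB6 g R₀ H₀) (X → ℝ)) {tD tR B₀ B₃ CR CR₁ κS δ₀ δ₃ δK δP ρ ρ₁ ρ' σ c Ce : ℝ}
    (hrow : RowSum (toB6 g R₀ H₀) σ c) (hc : 0 ≤ c) (htD : 0 ≤ tD) (htR : 0 ≤ tR) (hB₀ : 0 ≤ B₀) (hB₃ : 0 ≤ B₃) (hCR : 0 ≤ CR) (hCR₁ : 0 ≤ CR₁)
    (hκS : 1 ≤ κS) (hκ : bH.κ ≤ κS) (hκX : bXH.κ ≤ κS) (hκ2 : 𝔖₂.κ ≤ κS) (hκ1 : 𝔖₁.κ ≤ κS) (hσ : 0 ≤ σ) (hρ' : 0 < ρ') (hρ'ρ : ρ' + 3 * σ ≤ ρ)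
    (hρS : ρ ≤ δ₀) (hρ₃ : ρ ≤ δ₃) (hρ₁ : ρ₁ = ρ + σ) (hρP : ρ + 2 * σ ≤ δP) (hρK : ρ + 2 * σ ≤ δK)
    (hCea : const313 (κS * CR * tR * c) (κS * CR * tR * c) B₃ c ≤ Ce)
    (hCeb : B₀ + κS * tD * tR * c + κS * B₃ * B₃ * c + κS * tD * tR * c * B₃ * c +
      (B₃ + κS * tD * tR * c) * (B₃ * (B₃ * (κS * CR * tR * c) * c) * c) * c ≤ Ce)
    (hCec : κS * CR₁ * tR * c + κS * B₃ * B₃ * c + κS * CR₁ * tR * c * (B₃ * (B₃ * (κS * CR₁ * tR * c) * c) * c) * c ≤ Ce)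
    (he1 : HasMajorantHom (g := toB6 g R₀ H₀) 𝔬.blk 𝔬.blkY (𝔬.D U ∘ₗ 𝔬.G0 U) (fun (a b : g.Site) => B₀ * g.len a * Real.exp (-(δ₀ * g.dist a b))))
    {wZ : g.Site → ℝ} {hwZ : ∀ y, 0 < wZ y} (hL : Letters313Zc 𝔬 Gp R₀ H₀ hG wZ hwZ B₃ δ₃ bXH U) (hLD : Letters313DZ 𝔬 R₀ H₀ hG wZ hwZ B₃ δ₃ bH U)
    (hI : Identities 𝔬 U) (h152 : Ids3152 𝔬 Gp U)
    (hD2 : HasMaj 𝔖₂ (cNorm R₀ H₀ 𝔬.blkY hG.lenle 1) (𝔬.D U ∘ₗ 𝔬.G0 U ∘ₗ (𝔬.Tpi U + 𝔬.T2 U)) (fun a b => tD * Real.exp (-(δK * g.dist a b))))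
    (hG12 : HasMaj (cNorm R₀ H₀ 𝔬.blk hG.lenle 0) 𝔖₂ (𝔬.G1 U ∘ₗ LinearMap.id) (fun a b => tR * Real.exp (-(ρ₁ * g.dist a b))))
    (hGD2 : HasMaj (cNorm R₀ H₀ 𝔬.blkW hG.lenle 1) 𝔖₂ (𝔬.G1 U ∘ₗ 𝔬.Dv U) (fun a b => tR * Real.exp (-(ρ₁ * g.dist a b))))
    (hGQ2 : HasMaj (weightNorm (BlockNorm.ofBlocks (toB6 g R₀ H₀) 𝔬.blkZ) wZ fun y => (hwZ y).le) 𝔖₂ (𝔬.G1 U ∘ₗ 𝔬.Qstar U)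
      (fun a b => tR * Real.exp (-(ρ₁ * g.dist a b))))
    (hGDs1 : HasMaj (cNormR R₀ H₀ 𝔬.blkY hG.lenle 0) 𝔖₁ (𝔬.G1 U ∘ₗ 𝔬.Dstar U) (fun a b => tR * Real.exp (-(ρ₁ * g.dist a b))))
    (hGQ1 : HasMaj (weightNorm (BlockNorm.ofBlocks (toB6 g R₀ H₀) 𝔬.blkZ) (fun y => g.len y * wZ y) fun y => (wZlen_pos hG hwZ y).le) 𝔖₁
      (𝔬.G1 U ∘ₗ 𝔬.Qstar U) (fun a b => tR * Real.exp (-(ρ₁ * g.dist a b))))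
    (hRd2 : HasMaj 𝔖₂ (cNormR R₀ H₀ 𝔬.blk hG.lenle (-2)) LinearMap.id (fun a b => CR * Real.exp (-(δP * g.dist a b))))
    (hRd1 : HasMaj 𝔖₁ (cNormR R₀ H₀ 𝔬.blk hG.lenle (-1)) LinearMap.id (fun a b => CR₁ * Real.exp (-(δP * g.dist a b)))) :
    HasMajorant (g := toB6 g R₀ H₀) 𝔬.blk (𝔬.GG U) (fun a b => Ce * g.len a ^ 2 * Real.exp (-(ρ' * g.dist a b))) ∧
      HasMajorantHom (g := toB6 g R₀ H₀) 𝔬.blk 𝔬.blkY (𝔬.D U ∘ₗ 𝔬.GG U) (fun (a b : g.Site) => Ce * g.len a * Real.exp (-(ρ' * g.dist a b))) ∧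
      HasMajorantHom (g := toB6 g R₀ H₀) 𝔬.blkY 𝔬.blk (𝔬.GG U ∘ₗ 𝔬.Dstar U) (fun (a b : g.Site) => Ce * g.len a * Real.exp (-(ρ' * g.dist a b))) := by
  set A₂ : ℝ := κS * CR * tR * c with hA₂def
  set A₁ : ℝ := κS * CR₁ * tR * c with hA₁def
  have htri : Triangle254 (toB6 g R₀ H₀) := fun a b c => hG.tri a b c
  have hfix1 := fix_of_inverses hI.invG0' hI.invG1
  have hlen := hG.lenle
  have hκS0 : 0 ≤ κS := zero_le_one.trans hκS
  -- rates
  have hρ0 : 0 ≤ ρ := by linarith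
  have hρ₁0 : 0 ≤ ρ₁ := by rw [hρ₁]; linarith
  have hρρ₁ : ρ ≤ ρ₁ := by rw [hρ₁]; linarith
  have hρ₁K : ρ₁ + σ ≤ δK := by rw [hρ₁]; linarith
  have hρP' : ρ + σ ≤ δP := by linarith
  have hρK' : ρ + σ ≤ δK := by linarith
  have hρ'0 : 0 ≤ ρ' := hρ'.le
  have hρ'σ0 : 0 ≤ ρ' + σ := by linarith
  have hρ'σ₁ : ρ' + σ ≤ ρ₁ := by rw [hρ₁]; linarith
  have hρ'σK : ρ' + σ + σ ≤ δK := by linarith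
  have hρ'₃ : ρ' ≤ δ₃ := by linarith
  have hρ'σ₃ : ρ' + σ ≤ δ₃ := by linarith
  have hρ'₁ : ρ' ≤ ρ₁ := by linarith
  have hρ'K : ρ' + σ ≤ δK := by linarith
  -- the cutting costs of the middle classes below κ_S
  have hk2 : ∀ {a : ℝ}, 0 ≤ a → 𝔖₂.κ * a ≤ κS * a := fun ha => mul_le_mul_of_nonneg_right hκ2 ha
  have hk1 : ∀ {a : ℝ}, 0 ≤ a → 𝔖₁.κ * a ≤ κS * a := fun ha => mul_le_mul_of_nonneg_right hκ1 ha
  have hkk2 : ∀ {a : ℝ}, 0 ≤ a → 𝔖₂.κ * a * c ≤ κS * a * c := fun ha => mul_le_mul_of_nonneg_right (hk2 ha) hc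
  have hkk1 : ∀ {a : ℝ}, 0 ≤ a → 𝔖₁.κ * a * c ≤ κS * a * c := fun ha => mul_le_mul_of_nonneg_right (hk1 ha) hc
  have hA₂0 : 0 ≤ A₂ := mul_nonneg (mul_nonneg (mul_nonneg hκS0 hCR) htR) hc
  have hA₁0 : 0 ≤ A₁ := mul_nonneg (mul_nonneg (mul_nonneg hκS0 hCR₁) htR) hc
  have hTD0 : 0 ≤ κS * tD * tR * c := mul_nonneg (mul_nonneg (mul_nonneg hκS0 htD) htR) hc
  -- kernel weakening helper
  have wk : ∀ {F₁ F₂ : Type} [AddCommGroup F₁] [Module ℝ F₁] [AddCommGroup F₂] [Module ℝ F₂]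
      {b₁ : BlockNorm (toB6 g R₀ H₀) F₁} {b₂ : BlockNorm (toB6 g R₀ H₀) F₂} {T : F₁ →ₗ[ℝ] F₂} {C C' r₁ : ℝ},
      C ≤ C' → HasMaj b₁ b₂ T (fun a b => C * Real.exp (-(r₁ * g.dist a b))) → HasMaj b₁ b₂ T (fun a b => C' * Real.exp (-(r₁ * g.dist a b))) :=
    fun hCC h => h.mono fun a b => mul_le_mul_of_nonneg_right hCC (Real.exp_nonneg _)
  -- the sup readings in the integer classes
  have hRd2n : HasMaj 𝔖₂ (cNorm R₀ H₀ 𝔬.blk hG.lenle 2) LinearMap.id (fun a b => CR * Real.exp (-(δP * g.dist a b))) := by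
    intro y' μ hμ y
    have hb := hRd2 y' μ hμ y
    rwa [show (-2 : ℝ) = -((2 : ℕ) : ℝ) by norm_num, cNormR_loc_neg_natCast hG] at hb
  have hRd1n : HasMaj 𝔖₁ (cNorm R₀ H₀ 𝔬.blk hG.lenle 1) LinearMap.id (fun a b => CR₁ * Real.exp (-(δP * g.dist a b))) := by
    intro y' μ hμ y
    have hb := hRd1 y' μ hμ y
    rwa [show (-1 : ℝ) = -((1 : ℕ) : ℝ) by norm_num, cNormR_loc_neg_natCast hG] at hb
  -- (1) the right entries of G₁ read in the sup classes
  have hG1c : HasMaj (cNorm R₀ H₀ 𝔬.blk hG.lenle 0) (cNorm R₀ H₀ 𝔬.blk hG.lenle 2) (𝔬.G1 U ∘ₗ LinearMap.id)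
      (fun a b => A₂ * Real.exp (-(ρ * g.dist a b))) := by
    have h := hasMaj_read_of_state hG hrow htR hCR hρ0 hρρ₁ hρP' hG12 hRd2n
    rw [LinearMap.id_comp] at h
    exact wk (by rw [mul_assoc 𝔖₂.κ, mul_assoc 𝔖₂.κ]; exact (hk2 (by positivity)).trans (le_of_eq (by ring))) h
  have hGDc : HasMaj (cNorm R₀ H₀ 𝔬.blkW hG.lenle 1) (cNorm R₀ H₀ 𝔬.blk hG.lenle 2) (𝔬.G1 U ∘ₗ 𝔬.Dv U)
      (fun a b => A₂ * Real.exp (-(ρ * g.dist a b))) := by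
    have h := hasMaj_read_of_state hG hrow htR hCR hρ0 hρρ₁ hρP' hGD2 hRd2n
    rw [LinearMap.id_comp] at h
    exact wk (by rw [mul_assoc 𝔖₂.κ, mul_assoc 𝔖₂.κ]; exact (hk2 (by positivity)).trans (le_of_eq (by ring))) h
  have hGQc : HasMaj (weightNorm (BlockNorm.ofBlocks (toB6 g R₀ H₀) 𝔬.blkZ) wZ fun y => (hwZ y).le) (cNorm R₀ H₀ 𝔬.blk hG.lenle 2)
      (𝔬.G1 U ∘ₗ 𝔬.Qstar U) (fun a b => A₂ * Real.exp (-(ρ * g.dist a b))) := by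
    have h := hasMaj_read_of_state hG hrow htR hCR hρ0 hρρ₁ hρP' hGQ2 hRd2n
    rw [LinearMap.id_comp] at h
    exact wk (by rw [mul_assoc 𝔖₂.κ, mul_assoc 𝔖₂.κ]; exact (hk2 (by positivity)).trans (le_of_eq (by ring))) h
  have hGDsc : HasMaj (cNormR R₀ H₀ 𝔬.blkY hG.lenle 0) (cNorm R₀ H₀ 𝔬.blk hG.lenle 1) (𝔬.G1 U ∘ₗ 𝔬.Dstar U)
      (fun a b => A₁ * Real.exp (-(ρ * g.dist a b))) := by
    have h := hasMaj_read_of_state hG hrow htR hCR₁ hρ0 hρρ₁ hρP' hGDs1 hRd1n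
    rw [LinearMap.id_comp] at h
    exact wk (by rw [mul_assoc 𝔖₁.κ, mul_assoc 𝔖₁.κ]; exact (hk1 (by positivity)).trans (le_of_eq (by ring))) h
  have hGQ1c : HasMaj (weightNorm (BlockNorm.ofBlocks (toB6 g R₀ H₀) 𝔬.blkZ) (fun y => g.len y * wZ y) fun y => (wZlen_pos hG hwZ y).le)
      (cNorm R₀ H₀ 𝔬.blk hG.lenle 1) (𝔬.G1 U ∘ₗ 𝔬.Qstar U) (fun a b => A₁ * Real.exp (-(ρ * g.dist a b))) := by
    have h := hasMaj_read_of_state hG hrow htR hCR₁ hρ0 hρρ₁ hρP' hGQ1 hRd1n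
    rw [LinearMap.id_comp] at h
    exact wk (by rw [mul_assoc 𝔖₁.κ, mul_assoc 𝔖₁.κ]; exact (hk1 (by positivity)).trans (le_of_eq (by ring))) h
  -- (2) the left-and-right entries: ∇G₁, (∇G₀T)(G₁D), ∇G₁Q*
  have h10 : HasMaj (BlockNorm.ofBlocks (toB6 g R₀ H₀) 𝔬.blk) (BlockNorm.ofBlocks (toB6 g R₀ H₀) 𝔬.blkY) (𝔬.D U ∘ₗ 𝔬.G0 U)
      (fun a b => B₀ * g.len a * Real.exp (-(δ₀ * g.dist a b))) :=
    hasMaj_of_hasMajorantHom (G := toB6 g R₀ H₀) 𝔬.blk 𝔬.blkY (fun a b => mul_nonneg (mul_nonneg hB₀ (hG.lenle a)) (Real.exp_nonneg _)) he1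
  have hE1 : HasMaj (cNorm R₀ H₀ 𝔬.blk hG.lenle 0) (cNorm R₀ H₀ 𝔬.blkY hG.lenle 1) (𝔬.D U ∘ₗ 𝔬.G0 U ∘ₗ LinearMap.id)
      (fun a b => B₀ * Real.exp (-(δ₀ * g.dist a b))) := by
    rw [LinearMap.comp_id]
    refine (hasMaj_cNorm_of_hasMaj hG 1 0 h10).mono fun y y' => le_of_eq ?_
    have hy : g.len y ≠ 0 := (hG.lenpos y).ne'
    simp only [wt, pow_zero, pow_one, mul_one]
    rw [mul_assoc B₀, mul_comm (g.len y), ← mul_assoc B₀, mul_assoc, mul_inv_cancel₀ hy, mul_one]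
  have hD1 : HasMaj (cNorm R₀ H₀ 𝔬.blk hG.lenle 0) (cNorm R₀ H₀ 𝔬.blkY hG.lenle 1) (𝔬.D U ∘ₗ 𝔬.G1 U ∘ₗ LinearMap.id)
      (fun y y' => (B₀ + κS * tD * tR * c) * Real.exp (-(ρ * g.dist y y'))) := by
    have h := hasMaj_left_rightS hG hrow htD hB₀ htR hρ0 hρS hρρ₁ hρK' hD2 hE1 hG12 hfix1
    exact wk (by linarith only [hkk2 (mul_nonneg htD htR)]) h
  have hGDT : HasMaj (cNorm R₀ H₀ 𝔬.blkW hG.lenle 1) (cNorm R₀ H₀ 𝔬.blkY hG.lenle 1)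
      ((𝔬.D U ∘ₗ 𝔬.G0 U ∘ₗ (𝔬.Tpi U + 𝔬.T2 U)) ∘ₗ (𝔬.G1 U ∘ₗ 𝔬.Dv U)) (fun y y' => κS * tD * tR * c * Real.exp (-((ρ' + σ) * g.dist y y'))) := by
    have h := hasMaj_comp_exp htri hG.dnn hrow htD htR hρ'σ0 hρ'σ₁ hρ'σK hD2 hGD2
    exact wk (by rw [mul_assoc 𝔖₂.κ, mul_assoc 𝔖₂.κ, mul_assoc κS, mul_assoc κS]; exact hk2 (by positivity)) h
  have hD1Q : HasMaj (weightNorm (BlockNorm.ofBlocks (toB6 g R₀ H₀) 𝔬.blkZ) wZ fun y => (hwZ y).le) (cNorm R₀ H₀ 𝔬.blkY hG.lenle 1)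
      (𝔬.D U ∘ₗ 𝔬.G1 U ∘ₗ 𝔬.Qstar U) (fun y y' => (B₃ + κS * tD * tR * c) * Real.exp (-((ρ' + σ) * g.dist y y'))) := by
    have h := hasMaj_left_rightS hG hrow htD hB₃ htR hρ'σ0 hρ'σ₃ hρ'σ₁ hρ'σK hD2 hLD.dgQs hGQ2 hfix1
    exact wk (by linarith only [hkk2 (mul_nonneg htD htR)]) h
  have hKQ0 : 0 ≤ B₃ + κS * tD * tR * c := add_nonneg hB₃ hTD0
  -- (4) the three sup entries of 𝔊 at the constant Ce
  have hm0' := GG_entry0_of_members hG hrow hc hA₂0 hA₂0 hB₃ hσ hρ'0 hρ'ρ hρ₃ hG1c hGDc wZ hwZ hGQc hL.rgd2 hL.c1_2 hL.q2 hI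
  have hm1' := GG_entry1_of_members hG hrow hc hA₂0 (add_nonneg hB₀ hTD0) hTD0 hKQ0 hB₃ hσ hρ'0 hρ'ρ hρ₃ hG1c hD1 hGDT wZ hwZ hD1Q
    hL.rgd2 hL.c1_2 hL.q2 hLD hI
  have hGDsc0 : HasMaj (cNorm R₀ H₀ 𝔬.blkY hG.lenle 0) (cNorm R₀ H₀ 𝔬.blk hG.lenle 1) (𝔬.G1 U ∘ₗ 𝔬.Dstar U)
      (fun a b => A₁ * Real.exp (-(ρ * g.dist a b))) := by
    intro y' μ hμ y
    have hb := (hasMaj_of_in_zero hGDsc) y' μ hμ y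
    have e : (cNorm R₀ H₀ 𝔬.blkY hG.lenle 0).loc y' μ = (BlockNorm.ofBlocks (toB6 g R₀ H₀) 𝔬.blkY).loc y' μ := by
      simp only [cNorm, weightNorm_loc, wt, pow_zero, inv_one, one_mul]
    rw [e]; exact hb
  have hm2' := GG_entry2_of_members hG hrow hc hA₁0 hA₁0 hB₃ hB₃ hB₃ hσ hρ'0 hρ'ρ hρ₃ hGDsc0 (hwZ := hwZ) hGQ1c hL.c1_1 hL.q1 hL.gXH hL.wGp
    hI h152
  have hκH : bH.κ * B₃ * B₃ * c ≤ κS * B₃ * B₃ * c :=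
    mul_le_mul_of_nonneg_right (mul_le_mul_of_nonneg_right (mul_le_mul_of_nonneg_right hκ hB₃) hB₃) hc
  have hκXle : bXH.κ * B₃ * B₃ * c ≤ κS * B₃ * B₃ * c :=
    mul_le_mul_of_nonneg_right (mul_le_mul_of_nonneg_right (mul_le_mul_of_nonneg_right hκX hB₃) hB₃) hc
  have hle0 : const313 A₂ A₂ B₃ c ≤ Ce := hCea
  have hle1 : B₀ + κS * tD * tR * c + bH.κ * B₃ * B₃ * c + κS * tD * tR * c * B₃ * c +
      (B₃ + κS * tD * tR * c) * (B₃ * (B₃ * A₂ * c) * c) * c ≤ Ce := by linarith only [hCeb, hκH]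
  have hle2 : A₁ + bXH.κ * B₃ * B₃ * c + A₁ * (B₃ * (B₃ * A₁ * c) * c) * c ≤ Ce := by linarith only [hCec, hκXle]
  have hm0 : HasMajorant (g := toB6 g R₀ H₀) 𝔬.blk (𝔬.GG U) (fun a b => Ce * g.len a ^ 2 * Real.exp (-(ρ' * g.dist a b))) :=
    hasMajorant_mono (g := toB6 g R₀ H₀) 𝔬.blk hm0' fun a b =>
      mul_le_mul_of_nonneg_right (mul_le_mul_of_nonneg_right hle0 (sq_nonneg _)) (Real.exp_nonneg _)
  have hm1 : HasMajorantHom (g := toB6 g R₀ H₀) 𝔬.blk 𝔬.blkY (𝔬.D U ∘ₗ 𝔬.GG U)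
      (fun (a b : g.Site) => Ce * g.len a * Real.exp (-(ρ' * g.dist a b))) :=
    hasMajorantHom_mono (g := toB6 g R₀ H₀) 𝔬.blk 𝔬.blkY hm1' fun a b =>
      mul_le_mul_of_nonneg_right (mul_le_mul_of_nonneg_right hle1 (hlen a)) (Real.exp_nonneg _)
  have hm2 : HasMajorantHom (g := toB6 g R₀ H₀) 𝔬.blkY 𝔬.blk (𝔬.GG U ∘ₗ 𝔬.Dstar U)
      (fun (a b : g.Site) => Ce * g.len a * Real.exp (-(ρ' * g.dist a b))) :=
    hasMajorantHom_mono (g := toB6 g R₀ H₀) 𝔬.blkY 𝔬.blk hm2' fun a b =>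
      mul_le_mul_of_nonneg_right (mul_le_mul_of_nonneg_right hle2 (hlen a)) (Real.exp_nonneg _)
  exact ⟨hm0, hm1, hm2⟩

/-! ## §2 The two (3.43) probe majorants of 𝔊 from the state -/

omit [Fintype P] [DecidableEq g.Site] in
/-- ★★ **THE TWO (3.43) PROBE MAJORANTS OF 𝔊 FROM THE REGULAR STATE** (one member, one configuration): the probes of the G₁-words by the first resolvent form from
Theorem 3.3's `h43L ∕ h43R`, the probe fields of the states (Φ^Y_β∇_UG₀T out of 𝔖₂, Φ^X_βG₀T out of 𝔖₁), the probe letters `pQ ∕ pXQs ∕ pYDH ∕ pWE` and the right entries,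
then `GG_probe43L∕R_of_members`; both brought to ANY `C_u β` above the displayed polynomials (`hCuL ∕ hCuR`) and to the rate ρ₄ ≤ ρ′.
[cite: Balaban1985BackgroundPropagators, Thm 3.13 p.426 + Thm 3.12 p.423 + (3.43) p.398 + (3.152)–(3.153) p.426; Balaban1984PropagatorsII, (2.54) p.233 + Lemma 2.1 (2.61) p.234] -/
theorem GG_probes_of_stateS (hG : GeoOK g) (𝔭 : HolderProbes g B X Y PX PY) {𝔬 : Ops g B X Y Z W} {U : B.Cfg} {Dd Dds : B.Cfg → P → Module.End ℝ (X → ℝ)}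
    {bHX : ℝ → BlockNorm (toB6 g R₀ H₀) (X → ℝ)} {bH : BlockNorm (toB6 g R₀ H₀) (W → ℝ)} {Gp : B.Cfg → Module.End ℝ (W → ℝ)}
    {bXH : BlockNorm (toB6 g R₀ H₀) (X → ℝ)} (𝔖₂ 𝔖₁ : BlockNorm (toB6 g R₀ H₀) (X → ℝ)) {tR B₀ B₃ CR CR₁ κS δ₀ δ₃ δK δP ρ ρ₁ ρ' ρ₄ σ c : ℝ}
    {tH Bh Bi Bq BhD Bx Cu : ℝ → ℝ} {Bi2 : ℝ → ℝ → ℝ} (hrow : RowSum (toB6 g R₀ H₀) σ c) (hc : 0 ≤ c) (htR : 0 ≤ tR)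
    (htH : ∀ β, 0 ≤ β → β < 1 → 0 ≤ tH β) (hB₃ : 0 ≤ B₃) (hCR : 0 ≤ CR) (hCR₁ : 0 ≤ CR₁) (hκS : 1 ≤ κS) (hBh : ∀ β, 0 ≤ β → β < 1 → 0 ≤ Bh β)
    (hBq : ∀ β, 0 ≤ β → β < 1 → 0 ≤ Bq β) (hBhD : ∀ β, 0 ≤ β → β < 1 → 0 ≤ BhD β) (hBx : ∀ β, 0 ≤ β → β < 1 → 0 ≤ Bx β) (hκ : bH.κ ≤ κS)
    (hκX : bXH.κ ≤ κS) (hκ2 : 𝔖₂.κ ≤ κS) (hκ1 : 𝔖₁.κ ≤ κS) (hσ : 0 ≤ σ) (hρ' : 0 < ρ') (hρ'ρ : ρ' + 3 * σ ≤ ρ) (hρ₄ρ' : ρ₄ ≤ ρ') (hρS : ρ ≤ δ₀)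
    (hρ₃ : ρ ≤ δ₃) (hρ₁ : ρ₁ = ρ + σ) (hρP : ρ + 2 * σ ≤ δP) (hρK : ρ + 2 * σ ≤ δK) (hCu0 : ∀ β, 0 ≤ β → β < 1 → 0 ≤ Cu β)
    (hCuL : ∀ β, 0 ≤ β → β < 1 → (Bh β + κS * tH β * tR * c) + κS * BhD β * B₃ * c + κS * tH β * tR * c * B₃ * c +
      (Bq β + κS * tH β * tR * c) * (B₃ * (B₃ * (κS * CR * tR * c) * c) * c) * c ≤ Cu β)
    (hCuR : ∀ β, 0 ≤ β → β < 1 → (Bh β + κS * tH β * tR * c) + κS * Bx β * B₃ * c +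
      (Bx β + κS * tH β * tR * c) * (B₃ * (B₃ * (κS * CR₁ * tR * c) * c) * c) * c ≤ Cu β)
    (hH0 : Thm33G0Dir 𝔬 𝔭 Dd Dds R₀ H₀ bHX B₀ Bh Bi Bi2 δ₀ U) {wZ : g.Site → ℝ} {hwZ : ∀ y, 0 < wZ y}
    (hHH : LettersHHZ 𝔬 𝔭 R₀ H₀ hG.lenle (weightNorm (BlockNorm.ofBlocks (toB6 g R₀ H₀) 𝔬.blkZ) wZ fun y => (hwZ y).le) Bq δ₃ U)
    (hH3 : Letters313HZc 𝔬 𝔭 Gp R₀ H₀ hG wZ hwZ bH BhD Bx δ₃ bXH U) (hL : Letters313Zc 𝔬 Gp R₀ H₀ hG wZ hwZ B₃ δ₃ bXH U)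
    (hLD : Letters313DZ 𝔬 R₀ H₀ hG wZ hwZ B₃ δ₃ bH U) (hI : Identities 𝔬 U) (h152 : Ids3152 𝔬 Gp U)
    (hY2 : ∀ β : ℝ, 0 ≤ β → β < 1 → HasMaj 𝔖₂ (cNormR R₀ H₀ 𝔭.blkPY hG.lenle (β - 1))
      ((𝔭.ΦY U β ∘ₗ 𝔬.D U ∘ₗ 𝔬.G0 U) ∘ₗ (𝔬.Tpi U + 𝔬.T2 U)) (fun a b => tH β * Real.exp (-(δK * g.dist a b))))
    (hX1 : ∀ β : ℝ, 0 ≤ β → β < 1 → HasMaj 𝔖₁ (cNormR R₀ H₀ 𝔭.blkPX hG.lenle (β - 1))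
      ((𝔭.ΦX U β ∘ₗ 𝔬.G0 U) ∘ₗ (𝔬.Tpi U + 𝔬.T2 U)) (fun a b => tH β * Real.exp (-(δK * g.dist a b))))
    (hG12 : HasMaj (cNorm R₀ H₀ 𝔬.blk hG.lenle 0) 𝔖₂ (𝔬.G1 U ∘ₗ LinearMap.id) (fun a b => tR * Real.exp (-(ρ₁ * g.dist a b))))
    (hGD2 : HasMaj (cNorm R₀ H₀ 𝔬.blkW hG.lenle 1) 𝔖₂ (𝔬.G1 U ∘ₗ 𝔬.Dv U) (fun a b => tR * Real.exp (-(ρ₁ * g.dist a b))))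
    (hGQ2 : HasMaj (weightNorm (BlockNorm.ofBlocks (toB6 g R₀ H₀) 𝔬.blkZ) wZ fun y => (hwZ y).le) 𝔖₂ (𝔬.G1 U ∘ₗ 𝔬.Qstar U)
      (fun a b => tR * Real.exp (-(ρ₁ * g.dist a b))))
    (hGDs1 : HasMaj (cNormR R₀ H₀ 𝔬.blkY hG.lenle 0) 𝔖₁ (𝔬.G1 U ∘ₗ 𝔬.Dstar U) (fun a b => tR * Real.exp (-(ρ₁ * g.dist a b))))
    (hGQ1 : HasMaj (weightNorm (BlockNorm.ofBlocks (toB6 g R₀ H₀) 𝔬.blkZ) (fun y => g.len y * wZ y) fun y => (wZlen_pos hG hwZ y).le) 𝔖₁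
      (𝔬.G1 U ∘ₗ 𝔬.Qstar U) (fun a b => tR * Real.exp (-(ρ₁ * g.dist a b))))
    (hRd2 : HasMaj 𝔖₂ (cNormR R₀ H₀ 𝔬.blk hG.lenle (-2)) LinearMap.id (fun a b => CR * Real.exp (-(δP * g.dist a b))))
    (hRd1 : HasMaj 𝔖₁ (cNormR R₀ H₀ 𝔬.blk hG.lenle (-1)) LinearMap.id (fun a b => CR₁ * Real.exp (-(δP * g.dist a b)))) :
    (∀ β, 0 ≤ β → β < 1 → HasMajorantHom (g := toB6 g R₀ H₀) 𝔬.blk 𝔭.blkPY (𝔭.ΦY U β ∘ₗ (𝔬.D U ∘ₗ 𝔬.GG U))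
      (fun (a b : g.Site) => Cu β * g.len a ^ (1 - β) * Real.exp (-(ρ₄ * g.dist a b)))) ∧
    (∀ β, 0 ≤ β → β < 1 → HasMajorantHom (g := toB6 g R₀ H₀) 𝔬.blkY 𝔭.blkPX (𝔭.ΦX U β ∘ₗ (𝔬.GG U ∘ₗ 𝔬.Dstar U))
      (fun (a b : g.Site) => Cu β * g.len a ^ (1 - β) * Real.exp (-(ρ₄ * g.dist a b)))) := by
  set A₂ : ℝ := κS * CR * tR * c with hA₂def
  set A₁ : ℝ := κS * CR₁ * tR * c with hA₁def
  have htri : Triangle254 (toB6 g R₀ H₀) := fun a b c => hG.tri a b c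
  have hfix1 := fix_of_inverses hI.invG0' hI.invG1
  have hlen := hG.lenle
  have hκS0 : 0 ≤ κS := zero_le_one.trans hκS
  -- rates
  have hρ0 : 0 ≤ ρ := by linarith
  have hρ₁0 : 0 ≤ ρ₁ := by rw [hρ₁]; linarith
  have hρρ₁ : ρ ≤ ρ₁ := by rw [hρ₁]; linarith
  have hρ₁K : ρ₁ + σ ≤ δK := by rw [hρ₁]; linarith
  have hρP' : ρ + σ ≤ δP := by linarith
  have hρK' : ρ + σ ≤ δK := by linarith
  have hρ'0 : 0 ≤ ρ' := hρ'.le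
  have hρ'σ0 : 0 ≤ ρ' + σ := by linarith
  have hρ'σ₁ : ρ' + σ ≤ ρ₁ := by rw [hρ₁]; linarith
  have hρ'σK : ρ' + σ + σ ≤ δK := by linarith
  have hρ'₃ : ρ' ≤ δ₃ := by linarith
  have hρ'σ₃ : ρ' + σ ≤ δ₃ := by linarith
  have hρ'₁ : ρ' ≤ ρ₁ := by linarith
  have hρ'K : ρ' + σ ≤ δK := by linarith
  -- the cutting costs of the middle classes below κ_S
  have hk2 : ∀ {a : ℝ}, 0 ≤ a → 𝔖₂.κ * a ≤ κS * a := fun ha => mul_le_mul_of_nonneg_right hκ2 ha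
  have hk1 : ∀ {a : ℝ}, 0 ≤ a → 𝔖₁.κ * a ≤ κS * a := fun ha => mul_le_mul_of_nonneg_right hκ1 ha
  have hkk2 : ∀ {a : ℝ}, 0 ≤ a → 𝔖₂.κ * a * c ≤ κS * a * c := fun ha => mul_le_mul_of_nonneg_right (hk2 ha) hc
  have hkk1 : ∀ {a : ℝ}, 0 ≤ a → 𝔖₁.κ * a * c ≤ κS * a * c := fun ha => mul_le_mul_of_nonneg_right (hk1 ha) hc
  have hA₂0 : 0 ≤ A₂ := mul_nonneg (mul_nonneg (mul_nonneg hκS0 hCR) htR) hc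
  have hA₁0 : 0 ≤ A₁ := mul_nonneg (mul_nonneg (mul_nonneg hκS0 hCR₁) htR) hc
  -- kernel weakening helper
  have wk : ∀ {F₁ F₂ : Type} [AddCommGroup F₁] [Module ℝ F₁] [AddCommGroup F₂] [Module ℝ F₂]
      {b₁ : BlockNorm (toB6 g R₀ H₀) F₁} {b₂ : BlockNorm (toB6 g R₀ H₀) F₂} {T : F₁ →ₗ[ℝ] F₂} {C C' r₁ : ℝ},
      C ≤ C' → HasMaj b₁ b₂ T (fun a b => C * Real.exp (-(r₁ * g.dist a b))) → HasMaj b₁ b₂ T (fun a b => C' * Real.exp (-(r₁ * g.dist a b))) :=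
    fun hCC h => h.mono fun a b => mul_le_mul_of_nonneg_right hCC (Real.exp_nonneg _)
  -- the sup readings in the integer classes
  have hRd2n : HasMaj 𝔖₂ (cNorm R₀ H₀ 𝔬.blk hG.lenle 2) LinearMap.id (fun a b => CR * Real.exp (-(δP * g.dist a b))) := by
    intro y' μ hμ y
    have hb := hRd2 y' μ hμ y
    rwa [show (-2 : ℝ) = -((2 : ℕ) : ℝ) by norm_num, cNormR_loc_neg_natCast hG] at hb
  have hRd1n : HasMaj 𝔖₁ (cNorm R₀ H₀ 𝔬.blk hG.lenle 1) LinearMap.id (fun a b => CR₁ * Real.exp (-(δP * g.dist a b))) := by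
    intro y' μ hμ y
    have hb := hRd1 y' μ hμ y
    rwa [show (-1 : ℝ) = -((1 : ℕ) : ℝ) by norm_num, cNormR_loc_neg_natCast hG] at hb
  -- (1) the right entries of G₁ read in the sup classes
  have hG1c : HasMaj (cNorm R₀ H₀ 𝔬.blk hG.lenle 0) (cNorm R₀ H₀ 𝔬.blk hG.lenle 2) (𝔬.G1 U ∘ₗ LinearMap.id)
      (fun a b => A₂ * Real.exp (-(ρ * g.dist a b))) := by
    have h := hasMaj_read_of_state hG hrow htR hCR hρ0 hρρ₁ hρP' hG12 hRd2n
    rw [LinearMap.id_comp] at h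
    exact wk (by rw [mul_assoc 𝔖₂.κ, mul_assoc 𝔖₂.κ]; exact (hk2 (by positivity)).trans (le_of_eq (by ring))) h
  have hGDsc : HasMaj (cNormR R₀ H₀ 𝔬.blkY hG.lenle 0) (cNorm R₀ H₀ 𝔬.blk hG.lenle 1) (𝔬.G1 U ∘ₗ 𝔬.Dstar U)
      (fun a b => A₁ * Real.exp (-(ρ * g.dist a b))) := by
    have h := hasMaj_read_of_state hG hrow htR hCR₁ hρ0 hρρ₁ hρP' hGDs1 hRd1n
    rw [LinearMap.id_comp] at h
    exact wk (by rw [mul_assoc 𝔖₁.κ, mul_assoc 𝔖₁.κ]; exact (hk1 (by positivity)).trans (le_of_eq (by ring))) h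
  -- the same in the real classes
  have hG1r : HasMaj (cNormR R₀ H₀ 𝔬.blk hG.lenle 0) (cNormR R₀ H₀ 𝔬.blk hG.lenle (-2)) (𝔬.G1 U ∘ₗ LinearMap.id)
      (fun a b => A₂ * Real.exp (-(ρ * g.dist a b))) := by
    have h := hasMaj_toR hG hG1c
    simp only [Nat.cast_zero, neg_zero, Nat.cast_ofNat] at h
    exact h
  have hGDsr : HasMaj (cNormR R₀ H₀ 𝔬.blkY hG.lenle 0) (cNormR R₀ H₀ 𝔬.blk hG.lenle (-1)) (𝔬.G1 U ∘ₗ 𝔬.Dstar U)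
      (fun a b => A₁ * Real.exp (-(ρ * g.dist a b))) := by
    have h := hasMaj_toR_tgt hG hGDsc
    simp only [Nat.cast_one] at h
    exact h
  -- source conversions of the right entries
  have hG12r : HasMaj (cNormR R₀ H₀ 𝔬.blk hG.lenle 0) 𝔖₂ (𝔬.G1 U ∘ₗ LinearMap.id) (fun a b => tR * Real.exp (-(ρ₁ * g.dist a b))) := by
    have h := hasMaj_toR_src hG hG12
    simp only [Nat.cast_zero, neg_zero] at h
    exact h
  have hGD2r : HasMaj (cNormR R₀ H₀ 𝔬.blkW hG.lenle (-1)) 𝔖₂ (𝔬.G1 U ∘ₗ 𝔬.Dv U) (fun a b => tR * Real.exp (-(ρ₁ * g.dist a b))) := by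
    have h := hasMaj_toR_src hG hGD2
    simp only [Nat.cast_one] at h
    exact h
  -- their Φ^Y-probes
  have hD1p : ∀ β, 0 ≤ β → β < 1 → HasMaj (cNormR R₀ H₀ 𝔬.blk hG.lenle 0) (cNormR R₀ H₀ 𝔭.blkPY hG.lenle (β - 1))
      ((𝔭.ΦY U β ∘ₗ 𝔬.D U) ∘ₗ 𝔬.G1 U ∘ₗ LinearMap.id) (fun y y' => (Bh β + κS * tH β * tR * c) * Real.exp (-(ρ * g.dist y y'))) := by
    intro β h0 h1
    have hE0 : HasMaj (cNormR R₀ H₀ 𝔬.blk hG.lenle 0) (cNormR R₀ H₀ 𝔭.blkPY hG.lenle (β - 1)) ((𝔭.ΦY U β ∘ₗ 𝔬.D U) ∘ₗ 𝔬.G0 U ∘ₗ LinearMap.id)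
        (fun a b => Bh β * Real.exp (-(δ₀ * g.dist a b))) := by
      rw [LinearMap.comp_id]; exact (hasMaj_probe_cNormR_of_hom hG (hBh β h0 h1) (hH0.h43L β h0 h1)).congr fun μ => rfl
    have hP : HasMaj 𝔖₂ (cNormR R₀ H₀ 𝔭.blkPY hG.lenle (β - 1)) ((𝔭.ΦY U β ∘ₗ 𝔬.D U) ∘ₗ 𝔬.G0 U ∘ₗ (𝔬.Tpi U + 𝔬.T2 U))
        (fun a b => tH β * Real.exp (-(δK * g.dist a b))) := (hY2 β h0 h1).congr fun μ => rfl
    have h := hasMaj_left_rightS hG hrow (htH β h0 h1) (hBh β h0 h1) htR hρ0 hρS hρρ₁ hρK' hP hE0 hG12r hfix1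
    exact wk (by linarith only [hkk2 (mul_nonneg (htH β h0 h1) htR)]) h
  have hGDTp : ∀ β, 0 ≤ β → β < 1 → HasMaj (cNormR R₀ H₀ 𝔬.blkW hG.lenle (-1)) (cNormR R₀ H₀ 𝔭.blkPY hG.lenle (β - 1))
      (((𝔭.ΦY U β ∘ₗ 𝔬.D U) ∘ₗ 𝔬.G0 U ∘ₗ (𝔬.Tpi U + 𝔬.T2 U)) ∘ₗ (𝔬.G1 U ∘ₗ 𝔬.Dv U))
      (fun y y' => κS * tH β * tR * c * Real.exp (-((ρ' + σ) * g.dist y y'))) := by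
    intro β h0 h1
    have hP : HasMaj 𝔖₂ (cNormR R₀ H₀ 𝔭.blkPY hG.lenle (β - 1)) ((𝔭.ΦY U β ∘ₗ 𝔬.D U) ∘ₗ 𝔬.G0 U ∘ₗ (𝔬.Tpi U + 𝔬.T2 U))
        (fun a b => tH β * Real.exp (-(δK * g.dist a b))) := (hY2 β h0 h1).congr fun μ => rfl
    have h := hasMaj_comp_exp htri hG.dnn hrow (htH β h0 h1) htR hρ'σ0 hρ'σ₁ hρ'σK hP hGD2r
    exact wk (by rw [mul_assoc 𝔖₂.κ, mul_assoc 𝔖₂.κ, mul_assoc κS, mul_assoc κS]; exact hk2 (by have := htH β h0 h1; positivity)) h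
  have hD1Qp : ∀ β, 0 ≤ β → β < 1 → HasMaj (weightNorm (BlockNorm.ofBlocks (toB6 g R₀ H₀) 𝔬.blkZ) wZ fun y => (hwZ y).le)
      (cNormR R₀ H₀ 𝔭.blkPY hG.lenle (β - 1)) ((𝔭.ΦY U β ∘ₗ 𝔬.D U) ∘ₗ 𝔬.G1 U ∘ₗ 𝔬.Qstar U)
      (fun y y' => (Bq β + κS * tH β * tR * c) * Real.exp (-((ρ' + σ) * g.dist y y'))) := by
    intro β h0 h1
    have hP : HasMaj 𝔖₂ (cNormR R₀ H₀ 𝔭.blkPY hG.lenle (β - 1)) ((𝔭.ΦY U β ∘ₗ 𝔬.D U) ∘ₗ 𝔬.G0 U ∘ₗ (𝔬.Tpi U + 𝔬.T2 U))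
        (fun a b => tH β * Real.exp (-(δK * g.dist a b))) := (hY2 β h0 h1).congr fun μ => rfl
    have hEF : HasMaj (weightNorm (BlockNorm.ofBlocks (toB6 g R₀ H₀) 𝔬.blkZ) wZ fun y => (hwZ y).le) (cNormR R₀ H₀ 𝔭.blkPY hG.lenle (β - 1))
        ((𝔭.ΦY U β ∘ₗ 𝔬.D U) ∘ₗ 𝔬.G0 U ∘ₗ 𝔬.Qstar U) (fun a b => Bq β * Real.exp (-(δ₃ * g.dist a b))) := (hHH.pQ β h0 h1).congr fun μ => rfl
    have h := hasMaj_left_rightS hG hrow (htH β h0 h1) (hBq β h0 h1) htR hρ'σ0 hρ'σ₃ hρ'σ₁ hρ'σK hP hEF hGQ2 hfix1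
    exact wk (by linarith only [hkk2 (mul_nonneg (htH β h0 h1) htR)]) h
  -- the right probes Φ^X_βG₁∇*, Φ^X_βG₁Q*
  have hD1R : ∀ β, 0 ≤ β → β < 1 → HasMaj (cNormR R₀ H₀ 𝔬.blkY hG.lenle 0) (cNormR R₀ H₀ 𝔭.blkPX hG.lenle (β - 1))
      (𝔭.ΦX U β ∘ₗ 𝔬.G1 U ∘ₗ 𝔬.Dstar U) (fun y y' => (Bh β + κS * tH β * tR * c) * Real.exp (-(ρ * g.dist y y'))) := by
    intro β h0 h1
    have hE0 : HasMaj (cNormR R₀ H₀ 𝔬.blkY hG.lenle 0) (cNormR R₀ H₀ 𝔭.blkPX hG.lenle (β - 1)) (𝔭.ΦX U β ∘ₗ 𝔬.G0 U ∘ₗ 𝔬.Dstar U)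
        (fun a b => Bh β * Real.exp (-(δ₀ * g.dist a b))) := (hasMaj_probe_cNormR_of_hom hG (hBh β h0 h1) (hH0.h43R β h0 h1)).congr fun μ => rfl
    have hP : HasMaj 𝔖₁ (cNormR R₀ H₀ 𝔭.blkPX hG.lenle (β - 1)) (𝔭.ΦX U β ∘ₗ 𝔬.G0 U ∘ₗ (𝔬.Tpi U + 𝔬.T2 U))
        (fun a b => tH β * Real.exp (-(δK * g.dist a b))) := (hX1 β h0 h1).congr fun μ => rfl
    have h := hasMaj_left_rightS hG hrow (htH β h0 h1) (hBh β h0 h1) htR hρ0 hρS hρρ₁ hρK' hP hE0 hGDs1 hfix1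
    exact wk (by linarith only [hkk1 (mul_nonneg (htH β h0 h1) htR)]) h
  have hD1QR : ∀ β, 0 ≤ β → β < 1 →
      HasMaj (weightNorm (BlockNorm.ofBlocks (toB6 g R₀ H₀) 𝔬.blkZ) (fun y => g.len y * wZ y) fun y => (wZlen_pos hG hwZ y).le)
      (cNormR R₀ H₀ 𝔭.blkPX hG.lenle (β - 1)) (𝔭.ΦX U β ∘ₗ 𝔬.G1 U ∘ₗ 𝔬.Qstar U)
      (fun y y' => (Bx β + κS * tH β * tR * c) * Real.exp (-((ρ' + σ) * g.dist y y'))) := by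
    intro β h0 h1
    have hP : HasMaj 𝔖₁ (cNormR R₀ H₀ 𝔭.blkPX hG.lenle (β - 1)) (𝔭.ΦX U β ∘ₗ 𝔬.G0 U ∘ₗ (𝔬.Tpi U + 𝔬.T2 U))
        (fun a b => tH β * Real.exp (-(δK * g.dist a b))) := (hX1 β h0 h1).congr fun μ => rfl
    have hEF : HasMaj (weightNorm (BlockNorm.ofBlocks (toB6 g R₀ H₀) 𝔬.blkZ) (fun y => g.len y * wZ y) fun y => (wZlen_pos hG hwZ y).le)
        (cNormR R₀ H₀ 𝔭.blkPX hG.lenle (β - 1)) (𝔭.ΦX U β ∘ₗ 𝔬.G0 U ∘ₗ 𝔬.Qstar U)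
        (fun a b => Bx β * Real.exp (-(δ₃ * g.dist a b))) := (hH3.pXQs β h0 h1).congr fun μ => rfl
    have h := hasMaj_left_rightS hG hrow (htH β h0 h1) (hBx β h0 h1) htR hρ'σ0 hρ'σ₃ hρ'σ₁ hρ'σK hP hEF hGQ1 hfix1
    exact wk (by linarith only [hkk1 (mul_nonneg (htH β h0 h1) htR)]) h
  -- (6) the Hölder ∕ input block
  have hexp : ∀ a b : g.Site, Real.exp (-(ρ' * g.dist a b)) ≤ Real.exp (-(ρ₄ * g.dist a b)) := fun a b =>
    Real.exp_le_exp.mpr (neg_le_neg (mul_le_mul_of_nonneg_right hρ₄ρ' (hG.dnn a b)))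
  have hL43 : ∀ β, 0 ≤ β → β < 1 → HasMajorantHom (g := toB6 g R₀ H₀) 𝔬.blk 𝔭.blkPY (𝔭.ΦY U β ∘ₗ (𝔬.D U ∘ₗ 𝔬.GG U))
      (fun (a b : g.Site) => Cu β * g.len a ^ (1 - β) * Real.exp (-(ρ₄ * g.dist a b))) := by
    intro β h0 h1
    have hTH0 : 0 ≤ κS * tH β * tR * c := mul_nonneg (mul_nonneg (mul_nonneg hκS0 (htH β h0 h1)) htR) hc
    have h := GG_probe43L_of_members hG 𝔭 hrow hc hA₂0 (add_nonneg (hBh β h0 h1) hTH0) hTH0 (add_nonneg (hBq β h0 h1) hTH0) hB₃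
      (hBhD β h0 h1) hσ hρ'0 hρ'ρ hρ₃ hG1r (hD1p β h0 h1) (hGDTp β h0 h1) wZ hwZ (hD1Qp β h0 h1) (hH3.pYDH β h0 h1) hL.rgd2 hL.c1_2 hL.q2
      hLD.rgdH hI
    have hle : (Bh β + κS * tH β * tR * c) + bH.κ * BhD β * B₃ * c + κS * tH β * tR * c * B₃ * c +
        (Bq β + κS * tH β * tR * c) * (B₃ * (B₃ * A₂ * c) * c) * c ≤ Cu β := by
      have e1 : bH.κ * BhD β * B₃ * c ≤ κS * BhD β * B₃ * c :=
        mul_le_mul_of_nonneg_right (mul_le_mul_of_nonneg_right (mul_le_mul_of_nonneg_right hκ (hBhD β h0 h1)) hB₃) hc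
      linarith only [e1, hCuL β h0 h1]
    exact hasMajorantHom_mono (g := toB6 g R₀ H₀) 𝔬.blk 𝔭.blkPY h fun a b =>
      mul_le_mul (mul_le_mul_of_nonneg_right hle (Real.rpow_nonneg (hlen a) _)) (hexp a b) (Real.exp_nonneg _)
        (mul_nonneg (hCu0 β h0 h1) (Real.rpow_nonneg (hlen a) _))
  have hR43 : ∀ β, 0 ≤ β → β < 1 → HasMajorantHom (g := toB6 g R₀ H₀) 𝔬.blkY 𝔭.blkPX (𝔭.ΦX U β ∘ₗ (𝔬.GG U ∘ₗ 𝔬.Dstar U))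
      (fun (a b : g.Site) => Cu β * g.len a ^ (1 - β) * Real.exp (-(ρ₄ * g.dist a b))) := by
    intro β h0 h1
    have hTH0 : 0 ≤ κS * tH β * tR * c := mul_nonneg (mul_nonneg (mul_nonneg hκS0 (htH β h0 h1)) htR) hc
    have h := GG_probe43R_of_members hG 𝔭 hrow hc hA₁0 (add_nonneg (hBh β h0 h1) hTH0) (add_nonneg (hBx β h0 h1) hTH0) hB₃ hB₃
      (hBx β h0 h1) hσ hρ'0 hρ'ρ hρ₃ hGDsr (hD1R β h0 h1) (hwZ := hwZ) (hD1QR β h0 h1) hL.c1_1 hL.q1 hL.gXH (hH3.pWE β h0 h1) hI h152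
    have hle : (Bh β + κS * tH β * tR * c) + bXH.κ * Bx β * B₃ * c + (Bx β + κS * tH β * tR * c) * (B₃ * (B₃ * A₁ * c) * c) * c ≤ Cu β := by
      have e1 : bXH.κ * Bx β * B₃ * c ≤ κS * Bx β * B₃ * c :=
        mul_le_mul_of_nonneg_right (mul_le_mul_of_nonneg_right (mul_le_mul_of_nonneg_right hκX (hBx β h0 h1)) hB₃) hc
      linarith only [e1, hCuR β h0 h1]
    exact hasMajorantHom_mono (g := toB6 g R₀ H₀) 𝔬.blkY 𝔭.blkPX h fun a b =>
      mul_le_mul (mul_le_mul_of_nonneg_right hle (Real.rpow_nonneg (hlen a) _)) (hexp a b) (Real.exp_nonneg _)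
        (mul_nonneg (hCu0 β h0 h1) (Real.rpow_nonneg (hlen a) _))
  exact ⟨hL43, hR43⟩

/-! ## §3 The (3.44) ∕ (3.45) input lines of 𝔊 from the state -/

omit [Fintype PY] [DecidableEq g.Site] in
/-- ★★ **THE (3.44) ∕ (3.45) INPUT LINES OF 𝔊 ON THE PAIR FAMILY FROM THE REGULAR STATE** (one member, one configuration): per pair, the pieces ∇_{q.1}G₁∇\*_{q.2} (out of
`bHX ε`, Theorem 3.3's `h44m ∕ h45m`), ∇_νG₁D (out of `bHW ε`, the letters `dgDvd ∕ pdgDvd`), ∇_νG₁Q\* (out of Z_w by `dgQsd ∕ pQd`, transferred to Z_{len·w} by the scale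
transfer `hST1`) by the first resolvent form from the state fields ∇_{U,ν}G₀T, Φ^X_β∇_{U,ν}G₀T (out of 𝔖₁, resp. 𝔖₂ for the Z-pieces) and the right entries G₁∇\*_μ, G₁D, G₁Q\* INTO
the states; the right entry `G₁∇\*_μ : bHX ε → 𝔠⁽¹⁾` by the sup reading; then `GG_input44∕45Family_of_members`; brought to ANY `K₄₄ ε`, `K₄₅ ε β` above the displayed
polynomials and to the rate ρ₄ (ρ₄ + 3σ ≤ (1−α)ρ′).
[cite: Balaban1985BackgroundPropagators, Thm 3.13 p.426 + Thm 3.12 p.423 + (3.44)–(3.45) p.398 + (3.152)–(3.153) p.426; Balaban1984PropagatorsII, (2.52) p.232 + Lemma 2.1 (2.60)–(2.61) p.234] -/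
theorem GG_inputs_of_stateS (hG : GeoOK g) (𝔭 : HolderProbes g B X Y PX PY) {𝔬 : Ops g B X Y Z W} {U : B.Cfg} {Dd Dds : B.Cfg → P → Module.End ℝ (X → ℝ)}
    {bHX : ℝ → BlockNorm (toB6 g R₀ H₀) (X → ℝ)} {bHW : ℝ → BlockNorm (toB6 g R₀ H₀) (W → ℝ)} {bH : BlockNorm (toB6 g R₀ H₀) (W → ℝ)}
    {Gp : B.Cfg → Module.End ℝ (W → ℝ)} {bXH : BlockNorm (toB6 g R₀ H₀) (X → ℝ)} (𝔖₂ 𝔖₁ : BlockNorm (toB6 g R₀ H₀) (X → ℝ))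
    (Rel : g.Site → g.Site → Prop) {tD tR B₀ B₃ CR₁ κS Λ₁ δ₀ δ₃ δK δP ρ ρ₁ ρ' ρ₄ α σ c : ℝ} {tH tI tV Br Bh Bi Bq Bd K44 : ℝ → ℝ}
    {Bi2 Bd2 K45 : ℝ → ℝ → ℝ} (hrow : RowSum (toB6 g R₀ H₀) σ c) (hc : 0 ≤ c) (htD : 0 ≤ tD) (htR : 0 ≤ tR) (htH : ∀ β, 0 ≤ β → β < 1 → 0 ≤ tH β)
    (htI : ∀ ε, 0 < ε → 0 ≤ tI ε) (htV : ∀ ε, 0 < ε → 0 ≤ tV ε) (hB₃ : 0 ≤ B₃) (hCR₁ : 0 ≤ CR₁) (hκS : 1 ≤ κS) (hBr : ∀ ε, 0 < ε → 0 ≤ Br ε)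
    (hBi : ∀ ε, 0 < ε → ε ≤ 1 → 0 ≤ Bi ε) (hBq : ∀ β, 0 ≤ β → β < 1 → 0 ≤ Bq β) (hBd : ∀ ε, 0 < ε → ε ≤ 1 → 0 ≤ Bd ε)
    (hBi2 : ∀ ε β, 0 < ε → ε ≤ 1 → 0 ≤ β → β < 1 → 0 ≤ Bi2 ε β) (hBd2 : ∀ ε β, 0 < ε → ε ≤ 1 → 0 ≤ β → β < 1 → 0 ≤ Bd2 ε β)
    (hκW : ∀ ε, (bHW ε).κ ≤ κS) (hκ2 : 𝔖₂.κ ≤ κS) (hκ1 : 𝔖₁.κ ≤ κS) (hα0 : 0 ≤ α) (hσ : 0 ≤ σ) (hρ' : 0 < ρ') (hρ'ρ : ρ' + 3 * σ ≤ ρ) (hρ₄0 : 0 ≤ ρ₄)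
    (hρ₄r : ρ₄ + 3 * σ ≤ (1 - α) * ρ') (hρS : ρ ≤ δ₀) (hρ₃ : ρ ≤ δ₃) (hρ₁ : ρ₁ = ρ + σ) (hρP : ρ + 2 * σ ≤ δP) (hρK : ρ + 2 * σ ≤ δK)
    (hST1 : ScaleTransfer g ρ' α Λ₁ (fun y => g.len y ^ (1 : ℝ))) (hΛ₁0 : 0 ≤ Λ₁)
    (hK44le : ∀ ε, 0 < ε → ε ≤ 1 → (Bi ε + κS * tD * tI ε * c) + κS * (Bd ε + κS * tD * tV ε * c) * Br ε * c +
      (B₃ + κS * tD * tR * c) * Λ₁ * (B₃ * (B₃ * (κS * CR₁ * tI ε * c) * c) * c) * c ≤ K44 ε)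
    (hK45le : ∀ ε β, 0 < ε → ε ≤ 1 → 0 ≤ β → β < 1 → (Bi2 ε β + κS * tH β * tI (β + ε) * c) +
      κS * (Bd2 ε β + κS * tH β * tV (β + ε) * c) * Br (β + ε) * c +
      (Bq β + κS * tH β * tR * c) * Λ₁ * (B₃ * (B₃ * (κS * CR₁ * tI (β + ε) * c) * c) * c) * c ≤ K45 ε β)
    (hH0 : Thm33G0Dir 𝔬 𝔭 Dd Dds R₀ H₀ bHX B₀ Bh Bi Bi2 δ₀ U) {wZ : g.Site → ℝ} {hwZ : ∀ y, 0 < wZ y}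
    (hL : Letters313Zc 𝔬 Gp R₀ H₀ hG wZ hwZ B₃ δ₃ bXH U) (hLDM : Letters313DMZ 𝔬 𝔭 Dd R₀ H₀ hG wZ hwZ B₃ Bq δ₃ bH U)
    (hLIM : Letters313IMBC 𝔬 𝔭 Dd Dds R₀ H₀ hG.lenle bHX bHW Br tV Bd Bd2 δ₃ δK Rel U) (hI : Identities 𝔬 U)
    (hDd2 : ∀ ν : P, HasMaj 𝔖₂ (cNorm R₀ H₀ 𝔬.blk hG.lenle 1) (Dd U ν ∘ₗ 𝔬.G0 U ∘ₗ (𝔬.Tpi U + 𝔬.T2 U))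
      (fun a b => tD * Real.exp (-(δK * g.dist a b))))
    (hXd2 : ∀ (ν : P) (β : ℝ), 0 ≤ β → β < 1 → HasMaj 𝔖₂ (cNormR R₀ H₀ 𝔭.blkPX hG.lenle (β - 1))
      ((𝔭.ΦX U β ∘ₗ Dd U ν ∘ₗ 𝔬.G0 U) ∘ₗ (𝔬.Tpi U + 𝔬.T2 U)) (fun a b => tH β * Real.exp (-(δK * g.dist a b))))
    (hDd1 : ∀ ν : P, HasMaj 𝔖₁ (cNormR R₀ H₀ 𝔬.blk hG.lenle 0) (Dd U ν ∘ₗ 𝔬.G0 U ∘ₗ (𝔬.Tpi U + 𝔬.T2 U))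
      (fun a b => tD * Real.exp (-(δK * g.dist a b))))
    (hXd1 : ∀ (ν : P) (β : ℝ), 0 ≤ β → β < 1 → HasMaj 𝔖₁ (cNormR R₀ H₀ 𝔭.blkPX hG.lenle β)
      ((𝔭.ΦX U β ∘ₗ Dd U ν ∘ₗ 𝔬.G0 U) ∘ₗ (𝔬.Tpi U + 𝔬.T2 U)) (fun a b => tH β * Real.exp (-(δK * g.dist a b))))
    (hGQ2 : HasMaj (weightNorm (BlockNorm.ofBlocks (toB6 g R₀ H₀) 𝔬.blkZ) wZ fun y => (hwZ y).le) 𝔖₂ (𝔬.G1 U ∘ₗ 𝔬.Qstar U)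
      (fun a b => tR * Real.exp (-(ρ₁ * g.dist a b))))
    (hGI1 : ∀ (μ : P) (ε : ℝ), 0 < ε → HasMaj (bHX ε) 𝔖₁ (𝔬.G1 U ∘ₗ Dds U μ) (fun a b => tI ε * Real.exp (-(ρ₁ * g.dist a b))))
    (hGV1 : ∀ ε : ℝ, 0 < ε → HasMaj (bHW ε) 𝔖₁ (𝔬.G1 U ∘ₗ 𝔬.Dv U) (fun a b => tV ε * Real.exp (-(ρ₁ * g.dist a b))))
    (hRd1 : HasMaj 𝔖₁ (cNormR R₀ H₀ 𝔬.blk hG.lenle (-1)) LinearMap.id (fun a b => CR₁ * Real.exp (-(δP * g.dist a b)))) :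
    (∀ ε, 0 < ε → ε ≤ 1 → HasMaj (bHX ε) (BlockNorm.ofBlocks (toB6 g R₀ H₀) (𝔬.blk ∘ Prod.fst))
      (familyOp (fun q : P × P => Dd U q.1 ∘ₗ (𝔬.GG U ∘ₗ Dds U q.2))) (fun (a b : g.Site) => K44 ε * Real.exp (-(ρ₄ * g.dist a b)))) ∧
    (∀ ε β, 0 < ε → ε ≤ 1 → 0 ≤ β → β < 1 →
      HasMaj (bHX (β + ε)) (BlockNorm.ofBlocks (toB6 g R₀ H₀) (𝔭.blkPX ∘ Prod.fst))
      (sliceProbe (𝔭.ΦX U β) ∘ₗ familyOp (fun q : P × P => Dd U q.1 ∘ₗ (𝔬.GG U ∘ₗ Dds U q.2)))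
      (fun (a b : g.Site) => K45 ε β * g.len a ^ (-β) * Real.exp (-(ρ₄ * g.dist a b)))) := by
  set A₁ : ℝ := κS * CR₁ * tR * c with hA₁def
  have htri : Triangle254 (toB6 g R₀ H₀) := fun a b c => hG.tri a b c
  have hfix1 := fix_of_inverses hI.invG0' hI.invG1
  have hlen := hG.lenle
  have hκS0 : 0 ≤ κS := zero_le_one.trans hκS
  -- rates
  have hρ0 : 0 ≤ ρ := by linarith
  have hρ₁0 : 0 ≤ ρ₁ := by rw [hρ₁]; linarith
  have hρρ₁ : ρ ≤ ρ₁ := by rw [hρ₁]; linarith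
  have hρ₁K : ρ₁ + σ ≤ δK := by rw [hρ₁]; linarith
  have hρP' : ρ + σ ≤ δP := by linarith
  have hρK' : ρ + σ ≤ δK := by linarith
  have hρ'0 : 0 ≤ ρ' := hρ'.le
  have hρ'σ0 : 0 ≤ ρ' + σ := by linarith
  have hρ'σ₁ : ρ' + σ ≤ ρ₁ := by rw [hρ₁]; linarith
  have hρ'σK : ρ' + σ + σ ≤ δK := by linarith
  have hρ'₃ : ρ' ≤ δ₃ := by linarith
  have hρ'σ₃ : ρ' + σ ≤ δ₃ := by linarith
  have hρ'₁ : ρ' ≤ ρ₁ := by linarith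
  have hρ'K : ρ' + σ ≤ δK := by linarith
  have hρm0 : 0 ≤ ρ - σ := by linarith
  have hρm₀ : ρ - σ ≤ δ₀ := by linarith
  have hρm₃ : ρ - σ ≤ δ₃ := by linarith
  have hρm₁ : ρ - σ ≤ ρ₁ := by linarith
  have hρmK : ρ - σ + σ ≤ δK := by linarith
  set ρ₂ : ℝ := ρ₄ + 2 * σ with hρ₂def
  have hρ₂0 : 0 ≤ ρ₂ := by rw [hρ₂def]; linarith
  have h1α : (1 - α) * ρ' ≤ ρ' := by nlinarith
  have hρ₂α : ρ₂ ≤ (1 - α) * ρ' := by rw [hρ₂def]; linarith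
  have hρ₂m : ρ₂ ≤ ρ - σ := by linarith
  have hρ₂ρ : ρ₂ ≤ ρ := by linarith
  have hρ₂₃ : ρ₂ + σ ≤ δ₃ := by linarith
  -- the cutting costs of the middle classes below κ_S
  have hk2 : ∀ {a : ℝ}, 0 ≤ a → 𝔖₂.κ * a ≤ κS * a := fun ha => mul_le_mul_of_nonneg_right hκ2 ha
  have hk1 : ∀ {a : ℝ}, 0 ≤ a → 𝔖₁.κ * a ≤ κS * a := fun ha => mul_le_mul_of_nonneg_right hκ1 ha
  have hkk2 : ∀ {a : ℝ}, 0 ≤ a → 𝔖₂.κ * a * c ≤ κS * a * c := fun ha => mul_le_mul_of_nonneg_right (hk2 ha) hc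
  have hkk1 : ∀ {a : ℝ}, 0 ≤ a → 𝔖₁.κ * a * c ≤ κS * a * c := fun ha => mul_le_mul_of_nonneg_right (hk1 ha) hc
  have hA₁0 : 0 ≤ A₁ := mul_nonneg (mul_nonneg (mul_nonneg hκS0 hCR₁) htR) hc
  have hTD0 : 0 ≤ κS * tD * tR * c := mul_nonneg (mul_nonneg (mul_nonneg hκS0 htD) htR) hc
  -- kernel weakening helper
  have wk : ∀ {F₁ F₂ : Type} [AddCommGroup F₁] [Module ℝ F₁] [AddCommGroup F₂] [Module ℝ F₂]
      {b₁ : BlockNorm (toB6 g R₀ H₀) F₁} {b₂ : BlockNorm (toB6 g R₀ H₀) F₂} {T : F₁ →ₗ[ℝ] F₂} {C C' r₁ : ℝ},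
      C ≤ C' → HasMaj b₁ b₂ T (fun a b => C * Real.exp (-(r₁ * g.dist a b))) → HasMaj b₁ b₂ T (fun a b => C' * Real.exp (-(r₁ * g.dist a b))) :=
    fun hCC h => h.mono fun a b => mul_le_mul_of_nonneg_right hCC (Real.exp_nonneg _)
  have hRd1n : HasMaj 𝔖₁ (cNorm R₀ H₀ 𝔬.blk hG.lenle 1) LinearMap.id (fun a b => CR₁ * Real.exp (-(δP * g.dist a b))) := by
    intro y' μ hμ y
    have hb := hRd1 y' μ hμ y
    rwa [show (-1 : ℝ) = -((1 : ℕ) : ℝ) by norm_num, cNormR_loc_neg_natCast hG] at hb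
  -- (1) the right entry G₁∇*_μ read in the sup class
  have h2A : ∀ (μ : P) (ε : ℝ), 0 < ε → HasMaj (bHX ε) (cNorm R₀ H₀ 𝔬.blk hG.lenle 1) (𝔬.G1 U ∘ₗ Dds U μ)
      (fun a b => κS * CR₁ * tI ε * c * Real.exp (-(ρ * g.dist a b))) := by
    intro μ ε hε
    have h := hasMaj_read_of_state hG hrow (htI ε hε) hCR₁ hρ0 hρρ₁ hρP' (hGI1 μ ε hε) hRd1n
    rw [LinearMap.id_comp] at h
    exact wk (by rw [mul_assoc 𝔖₁.κ, mul_assoc 𝔖₁.κ, mul_assoc κS, mul_assoc κS]; exact hk1 (by have := htI ε hε; positivity)) h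
  -- (3) the (3.44) pieces per pair, at the rate ρ₂ = ρ₄ + 2σ
  have hGop : ∀ (q : P × P) (ε : ℝ), 0 < ε → ε ≤ 1 → HasMaj (bHX ε) (BlockNorm.ofBlocks (toB6 g R₀ H₀) 𝔬.blk)
      (Dd U q.1 ∘ₗ (𝔬.G1 U ∘ₗ Dds U q.2)) (fun a b => (Bi ε + κS * tD * tI ε * c) * Real.exp (-(ρ₂ * g.dist a b))) := by
    intro q ε hε0 hε1
    have h := input44_of_stateS hG hrow htD (hBi ε hε0 hε1) (htI ε hε0) hρm0 hρm₀ hρm₁ hρmK (hH0.h44m q ε hε0 hε1) (hDd1 q.1)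
      (hGI1 q.2 ε hε0) hfix1
    exact (wk (by linarith only [hkk1 (mul_nonneg htD (htI ε hε0))]) h).of_rate_le hG.dnn
      (by have := hBi ε hε0 hε1; have := htI ε hε0; positivity) hρ₂m
  have hGDv : ∀ (ν : P) (ε : ℝ), 0 < ε → ε ≤ 1 → HasMaj (bHW ε) (BlockNorm.ofBlocks (toB6 g R₀ H₀) 𝔬.blk)
      (Dd U ν ∘ₗ (𝔬.G1 U ∘ₗ 𝔬.Dv U)) (fun a b => (Bd ε + κS * tD * tV ε * c) * Real.exp (-(ρ₂ * g.dist a b))) := by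
    intro ν ε hε0 hε1
    have h44' : HasMaj (bHW ε) (cNormR R₀ H₀ 𝔬.blk hG.lenle 0) (Dd U ν ∘ₗ 𝔬.G0 U ∘ₗ 𝔬.Dv U)
        (fun (a b : g.Site) => Bd ε * Real.exp (-(δ₃ * g.dist a b))) := by
      intro y' μ hμ y
      rw [cNormR_loc, Real.rpow_zero, one_mul]
      exact (hLIM.dgDvd ν ε hε0 hε1) y' μ hμ y
    have h := hasMaj_left_rightS hG hrow htD (hBd ε hε0 hε1) (htV ε hε0) hρm0 hρm₃ hρm₁ hρmK (hDd1 ν) h44' (hGV1 ε hε0) hfix1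
    have h' : HasMaj (bHW ε) (BlockNorm.ofBlocks (toB6 g R₀ H₀) 𝔬.blk) (Dd U ν ∘ₗ (𝔬.G1 U ∘ₗ 𝔬.Dv U))
        (fun a b => (Bd ε + 𝔖₁.κ * tD * tV ε * c) * Real.exp (-((ρ - σ) * g.dist a b))) := (hasMaj_of_out_zero h).congr fun μ => rfl
    exact (wk (by linarith only [hkk1 (mul_nonneg htD (htV ε hε0))]) h').of_rate_le hG.dnn
      (by have := hBd ε hε0 hε1; have := htV ε hε0; positivity) hρ₂m
  have hKQ0 : 0 ≤ B₃ + κS * tD * tR * c := add_nonneg hB₃ hTD0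
  have hGQ44 : ∀ ν : P,
      HasMaj (weightNorm (BlockNorm.ofBlocks (toB6 g R₀ H₀) 𝔬.blkZ) (fun y => g.len y * wZ y) fun y => (wZlen_pos hG hwZ y).le)
      (BlockNorm.ofBlocks (toB6 g R₀ H₀) 𝔬.blk) (Dd U ν ∘ₗ 𝔬.G1 U ∘ₗ 𝔬.Qstar U)
      (fun a b => (B₃ + κS * tD * tR * c) * Λ₁ * Real.exp (-(ρ₂ * g.dist a b))) := by
    intro ν
    have hDQ : HasMaj (weightNorm (BlockNorm.ofBlocks (toB6 g R₀ H₀) 𝔬.blkZ) wZ fun y => (hwZ y).le) (cNorm R₀ H₀ 𝔬.blk hG.lenle 1)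
        (Dd U ν ∘ₗ 𝔬.G1 U ∘ₗ 𝔬.Qstar U) (fun y y' => (B₃ + κS * tD * tR * c) * Real.exp (-(ρ' * g.dist y y'))) := by
      have h := hasMaj_left_rightS hG hrow htD hB₃ htR hρ'0 hρ'₃ hρ'₁ hρ'K (hDd2 ν) (hLDM.dgQsd ν) hGQ2 hfix1
      exact wk (by linarith only [hkk2 (mul_nonneg htD htR)]) h
    have hDQR : HasMaj (weightNorm (BlockNorm.ofBlocks (toB6 g R₀ H₀) 𝔬.blkZ) wZ fun y => (hwZ y).le) (cNormR R₀ H₀ 𝔬.blk hG.lenle (-1))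
        (Dd U ν ∘ₗ 𝔬.G1 U ∘ₗ 𝔬.Qstar U) (fun y y' => (B₃ + κS * tD * tR * c) * Real.exp (-(ρ' * g.dist y y'))) := by
      have h := hasMaj_toR_tgt hG hDQ
      simp only [Nat.cast_one] at h
      exact h
    have hDQT := hasMaj_transfer_weight hG (fun y => (hwZ y).le) hKQ0 hST1 hDQR
    have e2 : (-1 : ℝ) + 1 = 0 := by ring
    rw [e2] at hDQT
    exact hasMaj_of_out_zero (hDQT.of_rate_le hG.dnn (mul_nonneg hKQ0 hΛ₁0) hρ₂α)
  -- the (3.45) pieces per pair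
  have hGop45 : ∀ (q : P × P) (ε β : ℝ), 0 < ε → ε ≤ 1 → 0 ≤ β → β < 1 →
      HasMaj (bHX (β + ε)) (cNormR R₀ H₀ 𝔭.blkPX hG.lenle β) ((𝔭.ΦX U β ∘ₗ Dd U q.1) ∘ₗ (𝔬.G1 U ∘ₗ Dds U q.2))
      (fun a b => (Bi2 ε β + κS * tH β * tI (β + ε) * c) * Real.exp (-(ρ₂ * g.dist a b))) := by
    intro q ε β hε0 hε1 hb0 hb1
    have hε' : 0 < β + ε := by linarith
    have hP : HasMaj 𝔖₁ (cNormR R₀ H₀ 𝔭.blkPX hG.lenle β) ((𝔭.ΦX U β ∘ₗ Dd U q.1) ∘ₗ 𝔬.G0 U ∘ₗ (𝔬.Tpi U + 𝔬.T2 U))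
        (fun a b => tH β * Real.exp (-(δK * g.dist a b))) := (hXd1 q.1 β hb0 hb1).congr fun μ => rfl
    have h45' : HasMaj (bHX (β + ε)) (BlockNorm.ofBlocks (toB6 g R₀ H₀) 𝔭.blkPX) ((𝔭.ΦX U β ∘ₗ Dd U q.1) ∘ₗ (𝔬.G0 U ∘ₗ Dds U q.2))
        (fun (a b : g.Site) => Bi2 ε β * g.len a ^ (-β) * Real.exp (-(δ₀ * g.dist a b))) := (hH0.h45m q ε β hε0 hε1 hb0 hb1).congr fun μ => rfl
    have h := input45_of_stateS hG hrow (htH β hb0 hb1) (hBi2 ε β hε0 hε1 hb0 hb1) (htI (β + ε) hε') hρm0 hρm₀ hρm₁ hρmK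
      h45' hP (hGI1 q.2 (β + ε) hε') hfix1
    have h' : HasMaj (bHX (β + ε)) (cNormR R₀ H₀ 𝔭.blkPX hG.lenle β) ((𝔭.ΦX U β ∘ₗ Dd U q.1) ∘ₗ (𝔬.G1 U ∘ₗ Dds U q.2))
        (fun a b => (Bi2 ε β + 𝔖₁.κ * tH β * tI (β + ε) * c) * Real.exp (-((ρ - σ) * g.dist a b))) :=
      hasMaj_weight_out hG (h.mono fun a b => le_of_eq (by ring))
    exact (wk (by linarith only [hkk1 (mul_nonneg (htH β hb0 hb1) (htI (β + ε) hε'))]) h').of_rate_le hG.dnn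
      (by have := hBi2 ε β hε0 hε1 hb0 hb1; have := htH β hb0 hb1; have := htI (β + ε) hε'; positivity) hρ₂m
  have hGD45 : ∀ (ν : P) (ε β : ℝ), 0 < ε → ε ≤ 1 → 0 ≤ β → β < 1 →
      HasMaj (bHW (β + ε)) (cNormR R₀ H₀ 𝔭.blkPX hG.lenle β) ((𝔭.ΦX U β ∘ₗ Dd U ν) ∘ₗ (𝔬.G1 U ∘ₗ 𝔬.Dv U))
      (fun a b => (Bd2 ε β + κS * tH β * tV (β + ε) * c) * Real.exp (-(ρ₂ * g.dist a b))) := by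
    intro ν ε β hε0 hε1 hb0 hb1
    have hε' : 0 < β + ε := by linarith
    have hP : HasMaj 𝔖₁ (cNormR R₀ H₀ 𝔭.blkPX hG.lenle β) ((𝔭.ΦX U β ∘ₗ Dd U ν) ∘ₗ 𝔬.G0 U ∘ₗ (𝔬.Tpi U + 𝔬.T2 U))
        (fun a b => tH β * Real.exp (-(δK * g.dist a b))) := (hXd1 ν β hb0 hb1).congr fun μ => rfl
    have h := input45_of_stateS hG hrow (htH β hb0 hb1) (hBd2 ε β hε0 hε1 hb0 hb1) (htV (β + ε) hε') hρm0 hρm₃ hρm₁ hρmK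
      (hLIM.pdgDvd ν ε β hε0 hε1 hb0 hb1) hP (hGV1 (β + ε) hε') hfix1
    have h' : HasMaj (bHW (β + ε)) (cNormR R₀ H₀ 𝔭.blkPX hG.lenle β) ((𝔭.ΦX U β ∘ₗ Dd U ν) ∘ₗ (𝔬.G1 U ∘ₗ 𝔬.Dv U))
        (fun a b => (Bd2 ε β + 𝔖₁.κ * tH β * tV (β + ε) * c) * Real.exp (-((ρ - σ) * g.dist a b))) :=
      hasMaj_weight_out hG (h.mono fun a b => le_of_eq (by ring))
    exact (wk (by linarith only [hkk1 (mul_nonneg (htH β hb0 hb1) (htV (β + ε) hε'))]) h').of_rate_le hG.dnn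
      (by have := hBd2 ε β hε0 hε1 hb0 hb1; have := htH β hb0 hb1; have := htV (β + ε) hε'; positivity) hρ₂m
  have hGQ45 : ∀ (ν : P) (β : ℝ), 0 ≤ β → β < 1 →
      HasMaj (weightNorm (BlockNorm.ofBlocks (toB6 g R₀ H₀) 𝔬.blkZ) (fun y => g.len y * wZ y) fun y => (wZlen_pos hG hwZ y).le)
      (cNormR R₀ H₀ 𝔭.blkPX hG.lenle β) ((𝔭.ΦX U β ∘ₗ Dd U ν) ∘ₗ 𝔬.G1 U ∘ₗ 𝔬.Qstar U)
      (fun a b => (Bq β + κS * tH β * tR * c) * Λ₁ * Real.exp (-(ρ₂ * g.dist a b))) := by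
    intro ν β hb0 hb1
    have hKQ' : 0 ≤ Bq β + κS * tH β * tR * c := add_nonneg (hBq β hb0 hb1) (mul_nonneg (mul_nonneg (mul_nonneg hκS0 (htH β hb0 hb1)) htR) hc)
    have hP : HasMaj 𝔖₂ (cNormR R₀ H₀ 𝔭.blkPX hG.lenle (β - 1)) ((𝔭.ΦX U β ∘ₗ Dd U ν) ∘ₗ 𝔬.G0 U ∘ₗ (𝔬.Tpi U + 𝔬.T2 U))
        (fun a b => tH β * Real.exp (-(δK * g.dist a b))) := (hXd2 ν β hb0 hb1).congr fun μ => rfl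
    have hEF : HasMaj (weightNorm (BlockNorm.ofBlocks (toB6 g R₀ H₀) 𝔬.blkZ) wZ fun y => (hwZ y).le) (cNormR R₀ H₀ 𝔭.blkPX hG.lenle (β - 1))
        ((𝔭.ΦX U β ∘ₗ Dd U ν) ∘ₗ 𝔬.G0 U ∘ₗ 𝔬.Qstar U) (fun a b => Bq β * Real.exp (-(δ₃ * g.dist a b))) := (hLDM.pQd ν β hb0 hb1).congr fun μ => rfl
    have hDQ : HasMaj (weightNorm (BlockNorm.ofBlocks (toB6 g R₀ H₀) 𝔬.blkZ) wZ fun y => (hwZ y).le) (cNormR R₀ H₀ 𝔭.blkPX hG.lenle (β - 1))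
        ((𝔭.ΦX U β ∘ₗ Dd U ν) ∘ₗ 𝔬.G1 U ∘ₗ 𝔬.Qstar U) (fun y y' => (Bq β + κS * tH β * tR * c) * Real.exp (-(ρ' * g.dist y y'))) := by
      have h := hasMaj_left_rightS hG hrow (htH β hb0 hb1) (hBq β hb0 hb1) htR hρ'0 hρ'₃ hρ'₁ hρ'K hP hEF hGQ2 hfix1
      exact wk (by linarith only [hkk2 (mul_nonneg (htH β hb0 hb1) htR)]) h
    have hDQT := hasMaj_transfer_weight hG (fun y => (hwZ y).le) hKQ' hST1 hDQ
    have e2 : β - 1 + 1 = β := by ring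
    rw [e2] at hDQT
    exact hDQT.of_rate_le hG.dnn (mul_nonneg hKQ' hΛ₁0) hρ₂α
  have h44 : ∀ ε, 0 < ε → ε ≤ 1 → HasMaj (bHX ε) (BlockNorm.ofBlocks (toB6 g R₀ H₀) (𝔬.blk ∘ Prod.fst))
      (familyOp (fun q : P × P => Dd U q.1 ∘ₗ (𝔬.GG U ∘ₗ Dds U q.2))) (fun (a b : g.Site) => K44 ε * Real.exp (-(ρ₄ * g.dist a b))) := by
    intro ε h0 h1
    have hI0 : 0 ≤ κS * CR₁ * tI ε * c := mul_nonneg (mul_nonneg (mul_nonneg hκS0 hCR₁) (htI ε h0)) hc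
    have h := GG_input44Family_of_members hG hrow hc hI0 hB₃ (hBr ε h0)
      (add_nonneg (hBi ε h0 h1) (mul_nonneg (mul_nonneg (mul_nonneg hκS0 htD) (htI ε h0)) hc))
      (add_nonneg (hBd ε h0 h1) (mul_nonneg (mul_nonneg (mul_nonneg hκS0 htD) (htV ε h0)) hc)) (mul_nonneg hKQ0 hΛ₁0) hσ hρ₄0 le_rfl hρ₂ρ hρ₂₃
      (fun μ => h2A μ ε h0) wZ hwZ hL.q1 hL.c1_1 hI (fun μ => hLIM.rgdd μ ε h0) (fun q => hGop q ε h0 h1) (fun ν => hGDv ν ε h0 h1) hGQ44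
    refine h.mono fun a b => mul_le_mul_of_nonneg_right ?_ (Real.exp_nonneg _)
    have e1 : (bHW ε).κ * (Bd ε + κS * tD * tV ε * c) * Br ε * c ≤ κS * (Bd ε + κS * tD * tV ε * c) * Br ε * c :=
      mul_le_mul_of_nonneg_right (mul_le_mul_of_nonneg_right (mul_le_mul_of_nonneg_right (hκW ε)
        (add_nonneg (hBd ε h0 h1) (mul_nonneg (mul_nonneg (mul_nonneg hκS0 htD) (htV ε h0)) hc))) (hBr ε h0)) hc
    linarith only [e1, hK44le ε h0 h1]
  have h45 : ∀ ε β, 0 < ε → ε ≤ 1 → 0 ≤ β → β < 1 →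
      HasMaj (bHX (β + ε)) (BlockNorm.ofBlocks (toB6 g R₀ H₀) (𝔭.blkPX ∘ Prod.fst))
      (sliceProbe (𝔭.ΦX U β) ∘ₗ familyOp (fun q : P × P => Dd U q.1 ∘ₗ (𝔬.GG U ∘ₗ Dds U q.2)))
      (fun (a b : g.Site) => K45 ε β * g.len a ^ (-β) * Real.exp (-(ρ₄ * g.dist a b))) := by
    intro ε β h0 h1 hb0 hb1
    have hε' : 0 < β + ε := by linarith
    have hI0 : 0 ≤ κS * CR₁ * tI (β + ε) * c := mul_nonneg (mul_nonneg (mul_nonneg hκS0 hCR₁) (htI (β + ε) hε')) hc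
    have hKQ' : 0 ≤ Bq β + κS * tH β * tR * c := add_nonneg (hBq β hb0 hb1) (mul_nonneg (mul_nonneg (mul_nonneg hκS0 (htH β hb0 hb1)) htR) hc)
    have h := GG_input45Family_of_members hG 𝔭 hrow hc hI0 hB₃ (hBr (β + ε) hε')
      (add_nonneg (hBi2 ε β h0 h1 hb0 hb1) (mul_nonneg (mul_nonneg (mul_nonneg hκS0 (htH β hb0 hb1)) (htI (β + ε) hε')) hc))
      (add_nonneg (hBd2 ε β h0 h1 hb0 hb1) (mul_nonneg (mul_nonneg (mul_nonneg hκS0 (htH β hb0 hb1)) (htV (β + ε) hε')) hc))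
      (mul_nonneg hKQ' hΛ₁0) hσ hρ₄0 le_rfl hρ₂ρ hρ₂₃
      (fun μ => h2A μ (β + ε) hε') wZ hwZ hL.q1 hL.c1_1 hI (fun μ => hLIM.rgdd μ (β + ε) hε') (fun q => hGop45 q ε β h0 h1 hb0 hb1)
      (fun ν => hGD45 ν ε β h0 h1 hb0 hb1) (fun ν => hGQ45 ν β hb0 hb1)
    refine h.mono fun a b => mul_le_mul_of_nonneg_right (mul_le_mul_of_nonneg_right ?_ (Real.rpow_nonneg (hlen a) _)) (Real.exp_nonneg _)
    have e1 : (bHW (β + ε)).κ * (Bd2 ε β + κS * tH β * tV (β + ε) * c) * Br (β + ε) * c ≤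
        κS * (Bd2 ε β + κS * tH β * tV (β + ε) * c) * Br (β + ε) * c :=
      mul_le_mul_of_nonneg_right (mul_le_mul_of_nonneg_right (mul_le_mul_of_nonneg_right (hκW (β + ε))
        (add_nonneg (hBd2 ε β h0 h1 hb0 hb1) (mul_nonneg (mul_nonneg (mul_nonneg hκS0 (htH β hb0 hb1)) (htV (β + ε) hε')) hc)))
        (hBr (β + ε) hε')) hc
    linarith only [e1, hK45le ε β h0 h1 hb0 hb1]
  exact ⟨h44, h45⟩

/-! ## §4 ★★★ The three blocks of a kernel family co-read by 𝔊, from the state -/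

/-- ★★★ **THEOREM 3.13 — THE SUP ENTRIES, THE L² BLOCK AND THE HÖLDER∕INPUT BLOCK OF A KERNEL FAMILY CO-READ BY 𝔊, FROM THE REGULAR STATE** (one member, one configuration;
the per-member residual of the row-21 S-leaf): `GG_entries_of_stateS` + `B9Thm313WholeGGBlocksEntries.GG_l2Block_of_entries` + `GG_probes_of_stateS` + `GG_inputs_of_stateS` +
`ineq343_345_of_majorants_pairM`.  CONCLUSION: (i) the three sup entries of 𝔊 at (C_e, ρ′); (ii) `L2Block K (mN·m·Cev·CL²·e^{rδ}·K₆) δ U`; (iii) `B9.Ineq343_345 K (β ↦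
m·CL·e^{rρ₄}·C_u β) (ε ↦ e^{rρ₄}·K₄₄ ε) ((ε,β) ↦ CL·e^{rρ₄}·K₄₅ ε β) ρ₄ U` — for ANY target constants above the displayed polynomials in the (uniform) input constants.
[cite: Balaban1985BackgroundPropagators, Thm 3.13 p.426 + Thm 3.12 pp.421–423 + (3.42)–(3.47) pp.397–398 + (3.152)–(3.153) p.426; Balaban1984PropagatorsII, (2.51)–(2.56) pp.232–233 + Lemma 2.1 (2.60)–(2.61) p.234] -/
theorem GG_blocks_of_stateS (hG : GeoOK g) (𝔭 : HolderProbes g B X Y PX PY) (K : B9.KernelFamily g B) {𝔬 : Ops g B X Y Z W} {U : B.Cfg}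
    {Dd Dds : B.Cfg → P → Module.End ℝ (X → ℝ)}
    {bHX : ℝ → BlockNorm (toB6 g R₀ H₀) (X → ℝ)} {bHW : ℝ → BlockNorm (toB6 g R₀ H₀) (W → ℝ)} {bH : BlockNorm (toB6 g R₀ H₀) (W → ℝ)}
    {Gp : B.Cfg → Module.End ℝ (W → ℝ)} {bXH : BlockNorm (toB6 g R₀ H₀) (X → ℝ)} (𝔖₂ 𝔖₁ : BlockNorm (toB6 g R₀ H₀) (X → ℝ))
    (Rel : g.Site → g.Site → Prop) [DecidableRel Rel] (ev : g.Loc → X → ℝ) (evY : g.Loc → Y → ℝ) {m mN : ℕ}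
    {r Cev CL tD tR θ₂' B₀ B₂ B₃ B₄ CR CR₁ κS Λ₁ Λh Λm Λu δ₀ δ₃ δK δP ρ ρ₁ ρ' ρ₄ α σ c δ Ce KGu K6 : ℝ}
    {tH tI tV Br Bh Bi Bq Bd BhD Bx Cu K44 : ℝ → ℝ} {Bi2 Bd2 K45 : ℝ → ℝ → ℝ}
    (hrow : RowSum (toB6 g R₀ H₀) σ c) (hc : 0 ≤ c) (htD : 0 ≤ tD) (htR : 0 ≤ tR) (htH : ∀ β, 0 ≤ β → β < 1 → 0 ≤ tH β)
    (htI : ∀ ε, 0 < ε → 0 ≤ tI ε) (htV : ∀ ε, 0 < ε → 0 ≤ tV ε) (hθ₂' : 0 ≤ θ₂') (hB₀ : 0 ≤ B₀) (hB₂ : 0 ≤ B₂) (hB₃ : 0 ≤ B₃) (hB₄ : 0 ≤ B₄)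
    (hCR : 0 ≤ CR) (hCR₁ : 0 ≤ CR₁) (hκS : 1 ≤ κS) (hBr : ∀ ε, 0 < ε → 0 ≤ Br ε)
    (hBh : ∀ β, 0 ≤ β → β < 1 → 0 ≤ Bh β) (hBi : ∀ ε, 0 < ε → ε ≤ 1 → 0 ≤ Bi ε) (hBq : ∀ β, 0 ≤ β → β < 1 → 0 ≤ Bq β)
    (hBd : ∀ ε, 0 < ε → ε ≤ 1 → 0 ≤ Bd ε) (hBi2 : ∀ ε β, 0 < ε → ε ≤ 1 → 0 ≤ β → β < 1 → 0 ≤ Bi2 ε β)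
    (hBd2 : ∀ ε β, 0 < ε → ε ≤ 1 → 0 ≤ β → β < 1 → 0 ≤ Bd2 ε β) (hBhD : ∀ β, 0 ≤ β → β < 1 → 0 ≤ BhD β)
    (hBx : ∀ β, 0 ≤ β → β < 1 → 0 ≤ Bx β)
    (hκ : bH.κ ≤ κS) (hκW : ∀ ε, (bHW ε).κ ≤ κS) (hκX : bXH.κ ≤ κS) (hκ2 : 𝔖₂.κ ≤ κS) (hκ1 : 𝔖₁.κ ≤ κS)
    (hα0 : 0 ≤ α) (hσ : 0 ≤ σ) (hρ' : 0 < ρ') (hρ'ρ : ρ' + 3 * σ ≤ ρ) (hρ'ρ₅ : ρ' + 5 * σ ≤ ρ)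
    (hρ₄0 : 0 ≤ ρ₄) (hρ₄r : ρ₄ + 3 * σ ≤ (1 - α) * ρ') (hρS : ρ ≤ δ₀) (hρ₃ : ρ ≤ δ₃) (hρ₁ : ρ₁ = ρ + σ) (hρP : ρ + 2 * σ ≤ δP)
    (hρK : ρ + 2 * σ ≤ δK) (hq₂1 : B₂ * θ₂' * c * c < 1) (hδ0 : 0 ≤ δ) (hδ1 : δ ≤ (1 - α) * ρ') (hδ2 : δ ≤ ρ')
    (hST1 : ScaleTransfer g ρ' α Λ₁ (fun y => g.len y ^ (1 : ℝ))) (hSTh : ScaleTransfer g ρ' α Λh (fun y => g.len y ^ (1 / 2 : ℝ)))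
    (hSTm : ScaleTransfer g ρ' α Λm (fun y => g.len y ^ (-1 : ℝ))) (hΛ₁0 : 0 ≤ Λ₁) (hΛ₁le : Λ₁ ≤ Λu) (hΛhle : Λh ≤ Λu)
    (hΛm0 : 0 ≤ Λm) (hΛmle : Λm ≤ Λu) (h1Λu : 1 ≤ Λu)
    -- the target constants, uniform in the leaf, and the inequalities they satisfy
    (hCe0 : 0 ≤ Ce) (hCea : const313 (κS * CR * tR * c) (κS * CR * tR * c) B₃ c ≤ Ce)
    (hCeb : B₀ + κS * tD * tR * c + κS * B₃ * B₃ * c + κS * tD * tR * c * B₃ * c +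
      (B₃ + κS * tD * tR * c) * (B₃ * (B₃ * (κS * CR * tR * c) * c) * c) * c ≤ Ce)
    (hCec : κS * CR₁ * tR * c + κS * B₃ * B₃ * c + κS * CR₁ * tR * c * (B₃ * (B₃ * (κS * CR₁ * tR * c) * c) * c) * c ≤ Ce)
    (hKGu0 : 0 ≤ KGu) (hKGle : constG46 (constKp B₂ B₄ θ₂' c) c ≤ KGu) (hK60 : 0 ≤ K6) (hK6a : Ce * Λu ≤ K6) (hK6b : KGu ≤ K6)
    (hK6c : Real.sqrt (Fintype.card (P × P)) * (KGu * Λu) ≤ K6)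
    (hCu0 : ∀ β, 0 ≤ β → β < 1 → 0 ≤ Cu β)
    (hCuL : ∀ β, 0 ≤ β → β < 1 → (Bh β + κS * tH β * tR * c) + κS * BhD β * B₃ * c + κS * tH β * tR * c * B₃ * c +
      (Bq β + κS * tH β * tR * c) * (B₃ * (B₃ * (κS * CR * tR * c) * c) * c) * c ≤ Cu β)
    (hCuR : ∀ β, 0 ≤ β → β < 1 → (Bh β + κS * tH β * tR * c) + κS * Bx β * B₃ * c +
      (Bx β + κS * tH β * tR * c) * (B₃ * (B₃ * (κS * CR₁ * tR * c) * c) * c) * c ≤ Cu β)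
    (hK440 : ∀ ε, 0 < ε → ε ≤ 1 → 0 ≤ K44 ε)
    (hK44le : ∀ ε, 0 < ε → ε ≤ 1 → (Bi ε + κS * tD * tI ε * c) + κS * (Bd ε + κS * tD * tV ε * c) * Br ε * c +
      (B₃ + κS * tD * tR * c) * Λ₁ * (B₃ * (B₃ * (κS * CR₁ * tI ε * c) * c) * c) * c ≤ K44 ε)
    (hK450 : ∀ ε β, 0 < ε → ε ≤ 1 → 0 ≤ β → β < 1 → 0 ≤ K45 ε β)
    (hK45le : ∀ ε β, 0 < ε → ε ≤ 1 → 0 ≤ β → β < 1 → (Bi2 ε β + κS * tH β * tI (β + ε) * c) +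
      κS * (Bd2 ε β + κS * tH β * tV (β + ε) * c) * Br (β + ε) * c +
      (Bq β + κS * tH β * tR * c) * Λ₁ * (B₃ * (B₃ * (κS * CR₁ * tI (β + ε) * c) * c) * c) * c ≤ K45 ε β)
    -- Theorem 3.3's members
    (he1 : HasMajorantHom (g := toB6 g R₀ H₀) 𝔬.blk 𝔬.blkY (𝔬.D U ∘ₗ 𝔬.G0 U) (fun (a b : g.Site) => B₀ * g.len a * Real.exp (-(δ₀ * g.dist a b))))
    (hH0 : Thm33G0Dir 𝔬 𝔭 Dd Dds R₀ H₀ bHX B₀ Bh Bi Bi2 δ₀ U)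
    -- the letters of record
    {wZ : g.Site → ℝ} {hwZ : ∀ y, 0 < wZ y}
    (hHH : LettersHHZ 𝔬 𝔭 R₀ H₀ hG.lenle (weightNorm (BlockNorm.ofBlocks (toB6 g R₀ H₀) 𝔬.blkZ) wZ fun y => (hwZ y).le) Bq δ₃ U)
    (hH3 : Letters313HZc 𝔬 𝔭 Gp R₀ H₀ hG wZ hwZ bH BhD Bx δ₃ bXH U)
    (hL : Letters313Zc 𝔬 Gp R₀ H₀ hG wZ hwZ B₃ δ₃ bXH U) (hLD : Letters313DZ 𝔬 R₀ H₀ hG wZ hwZ B₃ δ₃ bH U)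
    (hLDM : Letters313DMZ 𝔬 𝔭 Dd R₀ H₀ hG wZ hwZ B₃ Bq δ₃ bH U)
    (hLIM : Letters313IMBC 𝔬 𝔭 Dd Dds R₀ H₀ hG.lenle bHX bHW Br tV Bd Bd2 δ₃ δK Rel U) (hI : Identities 𝔬 U) (h152 : Ids3152 𝔬 Gp U)
    (hL2 : Thm33G0L2M 𝔬 Dd Dds R₀ H₀ B₂ ρ U)
    (hT : BlockBd (g := toB6 g R₀ H₀) 𝔬.blk 𝔬.blk (𝔬.Tpi U + 𝔬.T2 U)
      (fun (y y' : g.Site) => θ₂' * (g.len y)⁻¹ * (g.len y')⁻¹ * Real.exp (-(ρ * g.dist y y'))))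
    {vZ : g.Site → ℝ} {hvZ : ∀ y, 0 < vZ y}
    (hLt : Letters313L2Pc 𝔬 Dd Dds R₀ H₀ B₄ ρ vZ hvZ U) (hLM : Letters313L2MZ 𝔬 Dd Dds R₀ H₀ B₄ ρ vZ hvZ U)
    (hsym : IsTransposePair (𝔬.GG U) (𝔬.GG U)) (htr : IsTransposePair (𝔬.D U ∘ₗ 𝔬.GG U) (𝔬.GG U ∘ₗ 𝔬.Dstar U))
    -- the readings data
    (hRd₂ : ∀ a b b', Rel b b' → g.dist a b = g.dist a b')
    (hmult : ∀ y' : g.Site, (Finset.univ.filter (fun y'' => Rel y'' y')).card ≤ m)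
    (hnbr : ∀ y : g.Site, (nbr g r y).card ≤ mN)
    (hCL1 : 1 ≤ CL) (hCL : ∀ a a' : g.Site, g.dist a a' ≤ r → g.len a ≤ CL * g.len a') (hCev : 0 ≤ Cev)
    (hl0 : L2ReadsNbr (R := R₀) (H := H₀) K 0 U Rel r Cev 𝔬.blk 𝔬.blk ev (𝔬.GG U))
    (hl1 : L2ReadsNbr (R := R₀) (H := H₀) K 1 U Rel r Cev 𝔬.blkY 𝔬.blk ev (𝔬.D U ∘ₗ 𝔬.GG U))
    (hl2 : L2ReadsNbr (R := R₀) (H := H₀) K 2 U Rel r Cev 𝔬.blk 𝔬.blkY evY (𝔬.GG U ∘ₗ 𝔬.Dstar U))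
    (hl3 : L2ReadsNbr (R := R₀) (H := H₀) K 3 U Rel r Cev (𝔬.blk ∘ Prod.fst) 𝔬.blk ev
      (familyOp (fun q : P × P => Dd U q.1 ∘ₗ (𝔬.GG U ∘ₗ Dds U q.2))))
    (hl4 : L2ReadsNbr (R := R₀) (H := H₀) K 4 U Rel r Cev (𝔬.blk ∘ Prod.fst) 𝔬.blk ev
      (familyOp (fun q : P × P => (Dd U q.1 ∘ₗ Dd U q.2) ∘ₗ 𝔬.GG U)))
    (hl5 : L2ReadsNbr (R := R₀) (H := H₀) K 5 U Rel r Cev (𝔬.blk ∘ Prod.fst) 𝔬.blk ev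
      (familyOp (fun q : P × P => 𝔬.GG U ∘ₗ (Dds U q.1 ∘ₗ Dds U q.2))))
    (hH1 : H1ReadsNbr K U 𝔭 Rel r 𝔬.blk 𝔬.blkY ev evY (𝔬.D U ∘ₗ 𝔬.GG U) (𝔬.GG U ∘ₗ 𝔬.Dstar U))
    (hIn : InputReadsFam K U bHX r (𝔬.blk ∘ Prod.fst) (𝔭.blkPX ∘ Prod.fst) (fun β => sliceProbe (𝔭.ΦX U β)) ev
      (familyOp (fun q : P × P => Dd U q.1 ∘ₗ (𝔬.GG U ∘ₗ Dds U q.2))))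
    -- the step fields OUT OF the state classes, T = Δ′_π + Δ⁽²⁾_π
    (hD2 : HasMaj 𝔖₂ (cNorm R₀ H₀ 𝔬.blkY hG.lenle 1) (𝔬.D U ∘ₗ 𝔬.G0 U ∘ₗ (𝔬.Tpi U + 𝔬.T2 U)) (fun a b => tD * Real.exp (-(δK * g.dist a b))))
    (hDd2 : ∀ ν : P, HasMaj 𝔖₂ (cNorm R₀ H₀ 𝔬.blk hG.lenle 1) (Dd U ν ∘ₗ 𝔬.G0 U ∘ₗ (𝔬.Tpi U + 𝔬.T2 U))
      (fun a b => tD * Real.exp (-(δK * g.dist a b))))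
    (hY2 : ∀ β : ℝ, 0 ≤ β → β < 1 → HasMaj 𝔖₂ (cNormR R₀ H₀ 𝔭.blkPY hG.lenle (β - 1))
      ((𝔭.ΦY U β ∘ₗ 𝔬.D U ∘ₗ 𝔬.G0 U) ∘ₗ (𝔬.Tpi U + 𝔬.T2 U)) (fun a b => tH β * Real.exp (-(δK * g.dist a b))))
    (hXd2 : ∀ (ν : P) (β : ℝ), 0 ≤ β → β < 1 → HasMaj 𝔖₂ (cNormR R₀ H₀ 𝔭.blkPX hG.lenle (β - 1))
      ((𝔭.ΦX U β ∘ₗ Dd U ν ∘ₗ 𝔬.G0 U) ∘ₗ (𝔬.Tpi U + 𝔬.T2 U)) (fun a b => tH β * Real.exp (-(δK * g.dist a b))))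
    (hDd1 : ∀ ν : P, HasMaj 𝔖₁ (cNormR R₀ H₀ 𝔬.blk hG.lenle 0) (Dd U ν ∘ₗ 𝔬.G0 U ∘ₗ (𝔬.Tpi U + 𝔬.T2 U))
      (fun a b => tD * Real.exp (-(δK * g.dist a b))))
    (hX1 : ∀ β : ℝ, 0 ≤ β → β < 1 → HasMaj 𝔖₁ (cNormR R₀ H₀ 𝔭.blkPX hG.lenle (β - 1))
      ((𝔭.ΦX U β ∘ₗ 𝔬.G0 U) ∘ₗ (𝔬.Tpi U + 𝔬.T2 U)) (fun a b => tH β * Real.exp (-(δK * g.dist a b))))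
    (hXd1 : ∀ (ν : P) (β : ℝ), 0 ≤ β → β < 1 → HasMaj 𝔖₁ (cNormR R₀ H₀ 𝔭.blkPX hG.lenle β)
      ((𝔭.ΦX U β ∘ₗ Dd U ν ∘ₗ 𝔬.G0 U) ∘ₗ (𝔬.Tpi U + 𝔬.T2 U)) (fun a b => tH β * Real.exp (-(δK * g.dist a b))))
    -- the right entries of G₁ INTO the state classes
    (hG12 : HasMaj (cNorm R₀ H₀ 𝔬.blk hG.lenle 0) 𝔖₂ (𝔬.G1 U ∘ₗ LinearMap.id) (fun a b => tR * Real.exp (-(ρ₁ * g.dist a b))))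
    (hGD2 : HasMaj (cNorm R₀ H₀ 𝔬.blkW hG.lenle 1) 𝔖₂ (𝔬.G1 U ∘ₗ 𝔬.Dv U) (fun a b => tR * Real.exp (-(ρ₁ * g.dist a b))))
    (hGQ2 : HasMaj (weightNorm (BlockNorm.ofBlocks (toB6 g R₀ H₀) 𝔬.blkZ) wZ fun y => (hwZ y).le) 𝔖₂ (𝔬.G1 U ∘ₗ 𝔬.Qstar U)
      (fun a b => tR * Real.exp (-(ρ₁ * g.dist a b))))
    (hGDs1 : HasMaj (cNormR R₀ H₀ 𝔬.blkY hG.lenle 0) 𝔖₁ (𝔬.G1 U ∘ₗ 𝔬.Dstar U) (fun a b => tR * Real.exp (-(ρ₁ * g.dist a b))))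
    (hGQ1 : HasMaj (weightNorm (BlockNorm.ofBlocks (toB6 g R₀ H₀) 𝔬.blkZ) (fun y => g.len y * wZ y) fun y => (wZlen_pos hG hwZ y).le) 𝔖₁
      (𝔬.G1 U ∘ₗ 𝔬.Qstar U) (fun a b => tR * Real.exp (-(ρ₁ * g.dist a b))))
    (hGI1 : ∀ (μ : P) (ε : ℝ), 0 < ε → HasMaj (bHX ε) 𝔖₁ (𝔬.G1 U ∘ₗ Dds U μ) (fun a b => tI ε * Real.exp (-(ρ₁ * g.dist a b))))
    (hGV1 : ∀ ε : ℝ, 0 < ε → HasMaj (bHW ε) 𝔖₁ (𝔬.G1 U ∘ₗ 𝔬.Dv U) (fun a b => tV ε * Real.exp (-(ρ₁ * g.dist a b))))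
    -- the sup readings of the states
    (hRd2 : HasMaj 𝔖₂ (cNormR R₀ H₀ 𝔬.blk hG.lenle (-2)) LinearMap.id (fun a b => CR * Real.exp (-(δP * g.dist a b))))
    (hRd1 : HasMaj 𝔖₁ (cNormR R₀ H₀ 𝔬.blk hG.lenle (-1)) LinearMap.id (fun a b => CR₁ * Real.exp (-(δP * g.dist a b)))) :
    (HasMajorant (g := toB6 g R₀ H₀) 𝔬.blk (𝔬.GG U) (fun a b => Ce * g.len a ^ 2 * Real.exp (-(ρ' * g.dist a b))) ∧
      HasMajorantHom (g := toB6 g R₀ H₀) 𝔬.blk 𝔬.blkY (𝔬.D U ∘ₗ 𝔬.GG U) (fun (a b : g.Site) => Ce * g.len a * Real.exp (-(ρ' * g.dist a b))) ∧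
      HasMajorantHom (g := toB6 g R₀ H₀) 𝔬.blkY 𝔬.blk (𝔬.GG U ∘ₗ 𝔬.Dstar U) (fun (a b : g.Site) => Ce * g.len a * Real.exp (-(ρ' * g.dist a b)))) ∧
    L2Block K (mN * m * Cev * CL ^ 2 * Real.exp (r * δ) * K6) δ U ∧
    B9.Ineq343_345 K (fun β => m * CL * Real.exp (r * ρ₄) * Cu β) (fun ε => Real.exp (r * ρ₄) * K44 ε)
      (fun ε β => CL * Real.exp (r * ρ₄) * K45 ε β) ρ₄ U := by
  have h1α : (1 - α) * ρ' ≤ ρ' := by nlinarith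
  have hρ₄ρ' : ρ₄ ≤ ρ' := by linarith
  obtain ⟨hm0, hm1, hm2⟩ := GG_entries_of_stateS hG 𝔖₂ 𝔖₁ hrow hc htD htR hB₀ hB₃ hCR hCR₁ hκS hκ hκX hκ2 hκ1 hσ hρ' hρ'ρ hρS hρ₃ hρ₁ hρP hρK
    hCea hCeb hCec he1 hL hLD hI h152 hD2 hG12 hGD2 hGQ2 hGDs1 hGQ1 hRd2 hRd1
  obtain ⟨hL43, hR43⟩ := GG_probes_of_stateS hG 𝔭 𝔖₂ 𝔖₁ hrow hc htR htH hB₃ hCR hCR₁ hκS hBh hBq hBhD hBx hκ hκX hκ2 hκ1 hσ hρ' hρ'ρ hρ₄ρ'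
    hρS hρ₃ hρ₁ hρP hρK hCu0 hCuL hCuR hH0 hHH hH3 hL hLD hI h152 hY2 hX1 hG12 hGD2 hGQ2 hGDs1 hGQ1 hRd2 hRd1
  obtain ⟨h44, h45⟩ := GG_inputs_of_stateS hG 𝔭 𝔖₂ 𝔖₁ Rel hrow hc htD htR htH htI htV hB₃ hCR₁ hκS hBr hBi hBq hBd hBi2 hBd2 hκW hκ2 hκ1 hα0 hσ
    hρ' hρ'ρ hρ₄0 hρ₄r hρS hρ₃ hρ₁ hρP hρK hST1 hΛ₁0 hK44le hK45le hH0 hL hLDM hLIM hI hDd2 hXd2 hDd1 hXd1 hGQ2 hGI1 hGV1 hRd1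
  -- (5) the L² block at the entry line
  have hl2B := GG_l2Block_of_entries hG Rel ev evY hrow hc hθ₂' hB₂ hB₄ hσ hρ' hρ'ρ₅ hq₂1 hδ0 hδ1 hδ2 hST1 hSTh hSTm hΛ₁0 hΛ₁le hΛhle
    hΛm0 hΛmle h1Λu hCe0 hKGu0 hKGle hK60 hK6a hK6b hK6c hm0 hm1 hm2 hI hL2 hT hLt hLM hsym htr hRd₂ hmult hnbr hCL1 hCL hCev
    hl0 hl1 hl2 hl3 hl4 hl5
  have hHo := ineq343_345_of_majorants_pairM (R := R₀) (H := H₀) hG 𝔭 bHX hRd₂ hmult hCL1 hCL hCu0 hK440 hK450 hρ₄0 hL43 hR43 h44 h45 hH1 hIn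
  exact ⟨⟨hm0, hm1, hm2⟩, hl2B, hHo⟩

end OneMember

end

end Literature.MathematicalPhysics.QuantumFieldTheory.Balaban1983to89.B9Thm313WholeGGBlocksRegular
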